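import Literature.Combinatorics.Additive.PFR.FiniteRange
import Literature.Combinatorics.Additive.PFR.KernelEntropy
import Literature.Combinatorics.Additive.PFR.MeasureEntropy
import Literature.Combinatorics.Additive.PFR.MathlibExtras
import HarnessLib

/-!
# Shannon entropy, conditional entropy and mutual information of random variables (PFR library)

Topic `Literature/Combinatorics/Additive` — supporting library for the polynomial Freiman–Ruzsa theorem
(`Literature.Combinatorics.Additive.polynomialFreimanRuzsa`, Gowers–Green–Manners–Tao 2025).

**Provenance.** This file is a mechanical port of part of the public Lean formalisation of PFR,
`teorth/pfr` (https://github.com/teorth/pfr), commit `85d5879ae144` ("Bump to v4.32.0", Mathlib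
`81a5d257` = this tree's Mathlib), files:
* `PFR/ForMathlib/Entropy/Basic.lean`
* `PFR/ForMathlib/Entropy/Group.lean`
Copyright (c) 2023–2026 the PFR project contributors (T. Tao et al.); released under the Apache License 2.0;
see the upstream repository for the list of authors of each file. Changes made here (D-0022 layout):
upstream `module`/`public section` markers removed; declarations moved under
`namespace Literature.Combinatorics.Additive.PFR`: upstream `namespace ProbabilityTheory` content and root-level
content directly; upstream blocks `namespace X.Y` over a Mathlib namespace are kept textually (so that upstream's
name resolution inside them is unchanged) but every declaration in them that is NOT a generalized-field-notation
extension is renamed into `Literature.Combinatorics.Additive.PFR` (kernel lemmas into `….PFR.Kernel`); what stays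
in a Mathlib namespace are exactly the dot-notation extensions of Mathlib structures/predicates — a lemma `T.foo`
with an explicit argument (or result) of type `T …` for `T` among `IndepFun`, `iIndepFun`, `IdentDistrib`, `Kernel`,
`Measure`, `MeasurePreserving`, `ProbabilityMeasure`, `Set`, … — which keep the true Mathlib name `<ns>.T.foo` so that
upstream's `h.foo` / `.foo` call syntax elaborates (CONVENTIONS §2, deliberate dot-notation extensions). Exact
duplicates of Mathlib lemmas noticed in review are dropped in favour of Mathlib's; every declaration got a
docstring with a provenance tag. Upstream's global attribute edits on Mathlib declarations (e.g.
`attribute [symm] ProbabilityTheory.IdentDistrib.symm`, `attribute [mk_iff] ProbabilityTheory.IdentDistrib`) are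
kept as upstream has them. Statements and proofs are otherwise verbatim.

-/

namespace Literature.Combinatorics.Additive.PFR
end Literature.Combinatorics.Additive.PFR
open Literature.Combinatorics.Additive.PFR

/-! ## Port of `PFR/ForMathlib/Entropy/Basic.lean` -/
section PFR_ForMathlib_Entropy_Basic
/-!
# Entropy and conditional entropy

## Main definitions

* `entropy`: entropy of a random variable, defined as `measureEntropy (volume.map X)`
* `condEntropy`: conditional entropy of a random variable `X` w.r.t. another one `Y`
* `mutualInfo`: mutual information of two random variables

## Main statements

* `chain_rule`: $H[⟨X, Y⟩] = H[Y] + H[X | Y]$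
* `entropy_cond_le_entropy`: $H[X | Y] ≤ H[X]$. (Chain rule another way.)
* `entropy_triple_add_entropy_le` (Submodularity of entropy.) :
  $H[X, Y, Z] + H[Z] ≤ H[X, Z] + H[Y, Z]$.

## Notations

* `H[X] = entropy X`
* `H[X | Y ← y] = Hm[(ℙ[|Y ← y]).map X]`
* `H[X | Y] = condEntropy X Y`, such that `H[X | Y] = (volume.map Y)[fun y ↦ H[X | Y ← y]]`
* `I[X : Y] = mutualInfo X Y`

All notations have variants where we can specify the measure (which is otherwise
supposed to be `volume`). For example `H[X ; μ]` and `I[X : Y ; μ]` instead of `H[X]` and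
`I[X : Y]` respectively.

-/

open Function MeasureTheory Measure Real
open scoped ENNReal NNReal Topology ProbabilityTheory

namespace Literature.Combinatorics.Additive.PFR
open scoped ProbabilityTheory
open ProbabilityTheory
variable {Ω S T U T' : Type*} [mΩ : MeasurableSpace Ω] [MeasurableSpace S] [MeasurableSpace U]
  {X : Ω → S} {Y : Ω → T} {Z : Ω → U} {μ : Measure Ω}

section entropy

/-- Entropy of a random variable with values in a finite measurable space. [folklore] -/
noncomputable
def entropy (X : Ω → S) (μ : Measure Ω := by volume_tac) := Hm[μ.map X]

@[inherit_doc entropy] notation3:max "H[" X "; " μ "]" => entropy X μ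
@[inherit_doc entropy] notation3:max "H[" X "]" => entropy X volume
@[inherit_doc entropy] notation3:max "H[" X " | " Y " ← " y "; " μ "]" => entropy X (μ[|Y ← y])
@[inherit_doc entropy] notation3:max "H[" X " | " Y " ← " y "]" => entropy X (ℙ[|Y ← y])

/-- Entropy of a random variable agrees with entropy of its distribution. [folklore] -/
lemma entropy_def (X : Ω → S) (μ : Measure Ω) : entropy X μ = Hm[μ.map X] := rfl

/-- Entropy of a random variable is also the kernel entropy of the distribution over a Dirac mass.
 [folklore] -/
lemma entropy_eq_kernel_entropy (X : Ω → S) (μ : Measure Ω) :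
    H[X ; μ] = Hk[Kernel.const Unit (μ.map X), Measure.dirac ()] := by simp [entropy]

/-- Any variable on a zero measure space has zero entropy. [folklore] -/
@[simp]
lemma entropy_zero_measure (X : Ω → S) : H[X ; (0 : Measure Ω)] = 0 := by simp [entropy]

/-- Two variables that agree almost everywhere, have the same entropy. [folklore] -/
lemma entropy_congr {X X' : Ω → S} (h : X =ᵐ[μ] X') : H[X ; μ] = H[X' ; μ] := by
  rw [entropy_def, Measure.map_congr h, entropy_def]

/-- Entropy is always non-negative. [folklore] -/
lemma entropy_nonneg (X : Ω → S) (μ : Measure Ω) : 0 ≤ entropy X μ := measureEntropy_nonneg _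

open ProbabilityTheory.IdentDistrib in
/-- Two variables that have the same distribution, have the same entropy. [folklore] -/
lemma _root_.ProbabilityTheory.IdentDistrib.entropy_congr {Ω' : Type*} [MeasurableSpace Ω'] {μ' : Measure Ω'} {X' : Ω' → S}
    (h : IdentDistrib X X' μ μ') : H[X ; μ] = H[X' ; μ'] := by
  simp [entropy_def, h.map_eq]

/-- Entropy is at most the logarithm of the cardinality of the range. [folklore] -/
lemma entropy_le_log_card [Fintype S] [MeasurableSingletonClass S]
    (X : Ω → S) (μ : Measure Ω) : H[X ; μ] ≤ log (Fintype.card S) :=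
  measureEntropy_le_log_card _

/-- Entropy is at most the logarithm of the cardinality of a set in which X almost surely takes
values in. [folklore] -/
lemma entropy_le_log_card_of_mem [DiscreteMeasurableSpace S]
    {A : Finset S} {μ : Measure Ω} {X : Ω → S}
    (hX : Measurable X) (h : ∀ᵐ ω ∂μ, X ω ∈ A) :
    H[X ; μ] ≤ log A.card :=
  measureEntropy_le_log_card_of_mem _ <| by rwa [Measure.map_apply hX .of_discrete]

/-- Entropy is at most the logarithm of the cardinality of a set in which X almost surely takes
values in. [folklore] -/
lemma entropy_le_log_card_of_mem_finite [DiscreteMeasurableSpace S]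
    {A : Set S} {μ : Measure Ω} {X : Ω → S}
    (hA : A.Finite) (hX : Measurable X) (h : ∀ᵐ ω ∂μ, X ω ∈ A) :
    H[X ; μ] ≤ log (Nat.card A) := by
  lift A to Finset S using hA
  simpa using entropy_le_log_card_of_mem (A := A) hX (μ := μ) (by simpa)

/-- `H[X] = ∑ₛ P[X=s] log 1 / P[X=s]`. [folklore] -/
lemma entropy_eq_sum (μ : Measure Ω) [IsZeroOrProbabilityMeasure μ] :
    entropy X μ = ∑' x, negMulLog ((μ.map X).real {x}) := by
  rw [entropy_def, measureEntropy_of_isProbabilityMeasure]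

/-- `entropy_eq_sum'`: ported from PFR (`PFR/ForMathlib/Entropy/Basic.lean`). [folklore] -/
lemma entropy_eq_sum' (μ : Measure Ω) [IsZeroOrProbabilityMeasure μ] :
    entropy X μ = ∑' x, negMulLog ((μ.map X).real {x}) := by
  simp only [entropy_def, measureEntropy_of_isProbabilityMeasure, Measure.real]

/-- `entropy_eq_sum_finset`: ported from PFR (`PFR/ForMathlib/Entropy/Basic.lean`). [folklore] -/
lemma entropy_eq_sum_finset {μ : Measure Ω} [IsZeroOrProbabilityMeasure μ]
    {A : Finset S} (hA : (μ.map X) Aᶜ = 0) :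
    entropy X μ = ∑ x ∈ A, negMulLog ((μ.map X).real {x}) := by
  rw [entropy_eq_sum]
  convert tsum_eq_sum ?_
  · exact SummationFilter.instLeAtTopUnconditional S
  intro s hs
  convert negMulLog_zero
  rw [Measure.real]
  convert ENNReal.toReal_zero
  convert measure_mono_null ?_ hA
  simp [hs]

/-- `entropy_eq_sum_finset'`: ported from PFR (`PFR/ForMathlib/Entropy/Basic.lean`). [folklore] -/
lemma entropy_eq_sum_finset' {μ : Measure Ω} [IsZeroOrProbabilityMeasure μ]
    {A : Finset S} (hA : (μ.map X) Aᶜ = 0) :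
    entropy X μ = ∑ x ∈ A, negMulLog ((μ.map X).real {x}) :=
  entropy_eq_sum_finset hA

/-- `entropy_eq_sum_finiteRange`: ported from PFR (`PFR/ForMathlib/Entropy/Basic.lean`). [folklore] -/
lemma entropy_eq_sum_finiteRange [MeasurableSingletonClass S]
    (hX : Measurable X) {μ : Measure Ω} [IsZeroOrProbabilityMeasure μ] [FiniteRange X] :
    entropy X μ = ∑ x ∈ FiniteRange.toFinset X, negMulLog ((μ.map X).real {x}) :=
  entropy_eq_sum_finset (A := FiniteRange.toFinset X) (full_measure_of_finiteRange hX)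

/-- `entropy_eq_sum_finiteRange'`: ported from PFR (`PFR/ForMathlib/Entropy/Basic.lean`). [folklore] -/
lemma entropy_eq_sum_finiteRange' [MeasurableSingletonClass S] (hX : Measurable X) {μ : Measure Ω}
    [IsZeroOrProbabilityMeasure μ] [FiniteRange X] :
    entropy X μ = ∑ x ∈ FiniteRange.toFinset X, negMulLog ((μ.map X).real {x}) :=
  entropy_eq_sum_finiteRange hX

/-- `H[X | Y=y] = ∑_s P[X=s | Y=y] log 1/(P[X=s | Y=y])`. [folklore] -/
lemma entropy_cond_eq_sum (μ : Measure Ω) (y : T) :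
    H[X | Y ← y ; μ] = ∑' x, negMulLog (((μ[|Y ← y]).map X).real {x}) := by
  by_cases hy : μ (Y ⁻¹' {y}) = 0
  · rw [entropy_def, cond_eq_zero_of_meas_eq_zero hy]
    simp
  · rw [entropy_eq_sum]

/-- `entropy_cond_eq_sum_finiteRange`: ported from PFR (`PFR/ForMathlib/Entropy/Basic.lean`). [folklore] -/
lemma entropy_cond_eq_sum_finiteRange [MeasurableSingletonClass S]
    (hX : Measurable X) (μ : Measure Ω) (y : T) [FiniteRange X] :
    H[X | Y ← y ; μ] = ∑ x ∈ FiniteRange.toFinset X, negMulLog (((μ[|Y ← y]).map X).real {x}) := by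
  by_cases hy : μ (Y ⁻¹' {y}) = 0
  · rw [entropy_def, cond_eq_zero_of_meas_eq_zero hy]
    simp
  · rw [entropy_eq_sum_finiteRange hX]

/-- If `X`, `Y` are `S`-valued and `T`-valued random variables, and `Y = f(X)` for
some injection `f : S \to T`, then `H[Y] = H[X]`.
One can also use `entropy_of_comp_eq_of_comp` as an alternative if verifying injectivity is fiddly.
For the upper bound only, see `entropy_comp_le`. [folklore] -/
lemma entropy_comp_of_injective [MeasurableSpace T] [Countable S] [MeasurableSingletonClass S]
    [MeasurableSingletonClass T]
    (μ : Measure Ω) (hX : Measurable X) (f : S → T) (hf : Function.Injective f) :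
    H[f ∘ X ; μ] = H[X ; μ] := by
  have hf_m : Measurable f := .of_discrete
  rw [entropy_def, ← Measure.map_map hf_m hX, measureEntropy_map_of_injective _ _ hf_m hf,
    entropy_def]

/-- The entropy of any constant is zero. [folklore] -/
@[simp] lemma entropy_const [MeasurableSingletonClass S] [IsZeroOrProbabilityMeasure μ] (c : S) :
    H[fun _ ↦ c ; μ] = 0 := by
  rcases eq_zero_or_isProbabilityMeasure μ with rfl | hμ <;>
  simp [entropy, Measure.map_const]

open Set

open Function

/-- If `X` is uniformly distributed on `H`, then `H[X] = log |H|`. [folklore] -/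
lemma IsUniform.entropy_eq [DiscreteMeasurableSpace S] {H : Finset S} {X : Ω → S} {μ : Measure Ω}
    [IsProbabilityMeasure μ] (hX : IsUniform H X μ) (hX' : Measurable X) :
    H[X ; μ] = log (Nat.card H) := by
  have (t : S) : negMulLog ((μ.map X).real {t}) = (μ.map X).real {t} * log (Nat.card H) := by
    by_cases ht : t ∈ H
    · simp [negMulLog, IsUniform.measureReal_preimage_of_mem' hX hX' ht]
    · simp [negMulLog, map_measureReal_apply hX' (.singleton t), hX.measureReal_preimage_of_nmem ht]
  rw [entropy_eq_sum_finset' (A := H), Finset.sum_congr rfl (fun t _ ↦ this t), ← Finset.sum_mul,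
    sum_measureReal_singleton]
  · simp [Measure.real, IsUniform.full_measure hX hX']
  rw [Measure.map_apply hX' (by measurability)]
  exact hX.measure_preimage_compl

/-- Variant of `IsUniform.entropy_congr` where `H` is a finite `Set` rather than `Finset`. [folklore] -/
lemma IsUniform.entropy_eq' [DiscreteMeasurableSpace S]
    {A : Set S} (hA : A.Finite) {X : Ω → S} {μ : Measure Ω} [IsProbabilityMeasure μ]
    (hX : IsUniform A X μ) (hX' : Measurable X) : H[X ; μ] = log A.ncard := by
  have : IsUniform hA.toFinset X μ := by simpa using hX
  simpa using this.entropy_eq hX'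

/-- If `X` is `S`-valued random variable, then `H[X] = log |S|` if and only if `X` is uniformly
distributed. [folklore] -/
lemma entropy_eq_log_card {X : Ω → S} [Fintype S] [MeasurableSingletonClass S]
    (hX : Measurable X) (μ : Measure Ω) [hμ : NeZero μ]
    [IsFiniteMeasure μ] :
    entropy X μ = log (Fintype.card S) ↔ ∀ s, μ.map X {s} = μ Set.univ / Fintype.card S := by
  rcases eq_zero_or_neZero (μ.map X) with h | h
  · have := Measure.le_map_apply (@Measurable.aemeasurable Ω S _ _ X μ hX) Set.univ
    simp [h] at this; simp [this] at hμ
  have : IsFiniteMeasure (μ.map X) := by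
    apply Measure.isFiniteMeasure_map
  rw [entropy_def, measureEntropy_eq_card_iff_measure_eq, Measure.map_apply hX MeasurableSet.univ]
  simp

/-- If `X` is an `S`-valued random variable, then there exists `s ∈ S` such that
`P[X = s] ≥ \exp(- H[X])`.

TODO: remove the probability measure hypothesis, which is unnecessary here. [folklore] -/
lemma prob_ge_exp_neg_entropy [MeasurableSingletonClass S] (X : Ω → S) (μ : Measure Ω)
    [IsProbabilityMeasure μ] (hX : Measurable X) [hX' : FiniteRange X] :
    ∃ s : S, μ Set.univ * (rexp (- H[X ; μ])).toNNReal ≤ μ.map X {s} := by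
  have : Nonempty Ω := μ.nonempty_of_neZero
  have : Nonempty S := Nonempty.map X (by infer_instance)
  let μS := μ.map X
  let μs s := μS {s}
  rcases finiteSupport_of_finiteRange (X := X) with ⟨A, hA⟩
  let S_nonzero := A.filter (fun s ↦ μs s ≠ 0)
  set norm := μS A with rw_norm
  have h_norm : norm = μ Set.univ := by
    have := measure_add_measure_compl (μ := μS) (s := A) (Finset.measurableSet _)
    change μS (A : Set S)ᶜ = 0 at hA
    rw [hA, add_zero] at this
    simp [norm, μS, this, Measure.map_apply hX MeasurableSet.univ]
  let pdf_nn s := norm⁻¹ * μs s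
  let pdf s := (pdf_nn s).toReal
  let neg_log_pdf s := -log (pdf s)
  rcases Finset.eq_empty_or_nonempty S_nonzero with h_empty | h_nonempty
  · have h_norm_zero : μ Set.univ = 0 := by
      have h : ∀ s ∈ A, μs s ≠ 0 → μs s ≠ 0 := fun _ _ h ↦ h
      rw [← h_norm, rw_norm, ← sum_measure_singleton, ← Finset.sum_filter_of_ne h,
        show Finset.filter _ _ = S_nonzero from rfl, h_empty, show Finset.sum ∅ μs = 0 from rfl]
    use Classical.arbitrary (α := S)
    simp [h_norm_zero]
  rcases exists_or_forall_not (fun s ↦ μ.map X {s} = ∞) with h_infty | h_finite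
  · obtain ⟨s, h_s⟩ := h_infty
    use s; rw [h_s] ; exact le_top
  rcases eq_zero_or_neZero μ with h_zero_measure | _
  · use Classical.arbitrary (α := S)
    rw [h_zero_measure, show (0 : Measure Ω) _ = 0 from rfl, zero_mul]
    exact zero_le
  have h_norm_pos : 0 < norm := by
    rw [h_norm, Measure.measure_univ_pos]
    exact NeZero.ne μ
  have h_norm_finite : norm < ∞ := by
    rw [rw_norm, ← sum_measure_singleton]
    exact ENNReal.sum_lt_top.2 (fun s _ ↦ Ne.lt_top (h_finite s))
  have h_invinvnorm_finite : norm⁻¹⁻¹ ≠ ∞ := by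
    rw [inv_inv]
    exact LT.lt.ne_top h_norm_finite
  have h_invnorm_ne_zero : norm⁻¹ ≠ 0 := ENNReal.inv_ne_top.mp h_invinvnorm_finite
  have h_invnorm_finite : norm⁻¹ ≠ ∞ := by
    rw [← ENNReal.inv_ne_zero, inv_inv]
    exact h_norm_pos.ne'
  have h_pdf_finite : ∀ s, pdf_nn s ≠ ∞ := fun s ↦ ENNReal.mul_ne_top h_invnorm_finite (h_finite s)
  have h_norm_cancel : norm * norm⁻¹ = 1 := ENNReal.mul_inv_cancel h_norm_pos.ne' h_norm_finite.ne
  have h_pdf1 : (∑ s ∈ A, pdf s) = 1 := by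
    rw [← ENNReal.toReal_sum (fun s _ ↦ h_pdf_finite s), ← Finset.mul_sum,
      sum_measure_singleton, mul_comm, h_norm_cancel, ENNReal.toReal_one]
  let ⟨s_max, hs, h_min⟩ := Finset.exists_min_image S_nonzero neg_log_pdf h_nonempty
  have h_pdf_s_max_pos : 0 < pdf s_max := by
    rw [Finset.mem_filter] at hs
    have h_nonzero : pdf s_max ≠ 0 := ENNReal.toReal_ne_zero.mpr
      ⟨mul_ne_zero h_invnorm_ne_zero hs.2, ENNReal.mul_ne_top h_invnorm_finite (h_finite s_max)⟩
    exact LE.le.lt_of_ne ENNReal.toReal_nonneg h_nonzero.symm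
  use s_max
  rw [← h_norm, ← one_mul (μ.map X _), ← h_norm_cancel, mul_assoc]
  apply mul_le_mul_of_nonneg_left _ (le_of_lt h_norm_pos)
  change ENNReal.ofReal (rexp (-H[X ; μ])) ≤ pdf_nn s_max
  rw [ENNReal.ofReal_le_iff_le_toReal (h_pdf_finite _),
    show (pdf_nn _).toReal = pdf _ from rfl, ← Real.exp_log h_pdf_s_max_pos]
  apply exp_monotone
  rw [neg_le, ← one_mul (-log _), ← h_pdf1, Finset.sum_mul]
  let g_lhs s := pdf s * neg_log_pdf s_max
  let g_rhs s := -pdf s * log (pdf s)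
  suffices ∑ s ∈ A, g_lhs s ≤ ∑ s ∈ A, g_rhs s by
    convert! this
    rw [entropy_eq_sum_finset hA]
    congr with s
    simp only [negMulLog, neg_mul, ENNReal.toReal_mul, neg_inj, g_rhs, pdf, pdf_nn]
    simp at h_norm
    simp [h_norm, μs, μS, Measure.real]
  have h_lhs : ∀ s, μs s = 0 → g_lhs s = 0 := by {intros _ h; simp [g_lhs, pdf, pdf_nn, h]}
  have h_rhs : ∀ s, μs s = 0 → g_rhs s = 0 := by {intros _ h; simp [g_rhs, pdf, pdf_nn, h]}
  rw [← Finset.sum_filter_of_ne (fun s _ ↦ (h_lhs s).mt),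
    ← Finset.sum_filter_of_ne (fun s _ ↦ (h_rhs s).mt)]
  apply Finset.sum_le_sum
  intros s h_s
  rw [show g_lhs s = _ * _ from rfl, show g_rhs s = _ * _ from rfl, neg_mul_comm]
  exact mul_le_mul_of_nonneg_left (h_min s h_s) ENNReal.toReal_nonneg

/-- If `X` is an `S`-valued random variable, then there exists `s ∈ S` such that
`P[X=s] ≥ \exp(-H[X])`. [folklore] -/
lemma prob_ge_exp_neg_entropy' [MeasurableSingletonClass S]
    {Ω : Type*} [MeasurableSpace Ω] {μ : Measure Ω}
    [IsProbabilityMeasure μ] (X : Ω → S) (hX : Measurable X) [FiniteRange X] :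
    ∃ s : S, rexp (- H[X ; μ]) ≤ μ.real (X ⁻¹' {s}) := by
  obtain ⟨s, hs⟩ := prob_ge_exp_neg_entropy X μ hX
  use s
  rwa [IsProbabilityMeasure.measure_univ, one_mul,
    (show ENNReal.ofNNReal _ = ENNReal.ofReal _ from rfl),
    ENNReal.ofReal_le_iff_le_toReal (measure_ne_top _ _), ← Measure.real,
    map_measureReal_apply hX (MeasurableSet.singleton s)] at hs

/-- If `X` is an `S`-valued random variable of non-positive entropy, then `X` is almost surely
constant. [folklore] -/
lemma const_of_nonpos_entropy [MeasurableSingletonClass S]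
    {Ω : Type*} [MeasurableSpace Ω] {μ : Measure Ω}
    [IsProbabilityMeasure μ] {X : Ω → S} (hX : Measurable X) [FiniteRange X] (hent : H[X; μ] ≤ 0) :
    ∃ s : S, μ.real (X ⁻¹' {s}) = 1 := by
    rcases prob_ge_exp_neg_entropy' (μ := μ) X hX with ⟨ s, hs ⟩
    use s
    apply LE.le.antisymm
    · rw [← probReal_univ (μ := μ)]
      exact measureReal_mono (subset_univ _) (by finiteness)
    refine le_trans ?_ hs
    simp [hent]

variable [Countable S] [MeasurableSingletonClass S]
  [MeasurableSpace T] [MeasurableSingletonClass T]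
  [Countable U] [MeasurableSingletonClass U]

/-- `H[X, f(X)] = H[X]`. [folklore] -/
@[simp] lemma entropy_prod_comp (hX : Measurable X) (μ : Measure Ω) (f : S → T) :
    H[⟨X, f ∘ X⟩; μ] = H[X ; μ] :=
  entropy_comp_of_injective μ hX (fun x ↦ (x, f x)) fun _ _ ab ↦ (Prod.ext_iff.1 ab).1

variable [Countable T]

/-- `H[X, Y] = H[Y, X]`. [folklore] -/
lemma entropy_comm (hX : Measurable X) (hY : Measurable Y) (μ : Measure Ω) :
    H[⟨X, Y⟩; μ] = H[⟨Y, X⟩ ; μ] := by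
  change H[Prod.swap ∘ ⟨Y, X⟩ ; μ] = H[⟨Y, X⟩ ; μ]
  exact entropy_comp_of_injective μ (hY.prodMk hX) Prod.swap Prod.swap_injective

/-- `H[(X, Y), Z] = H[X, (Y, Z)]`. [folklore] -/
lemma entropy_assoc (hX : Measurable X) (hY : Measurable Y) (hZ : Measurable Z) (μ : Measure Ω) :
    H[⟨X, ⟨Y, Z⟩⟩ ; μ] = H[⟨⟨X, Y⟩, Z⟩ ; μ] := by
  change H[MeasurableEquiv.prodAssoc ∘ ⟨⟨X, Y⟩, Z⟩ ; μ] = H[⟨⟨X, Y⟩, Z⟩ ; μ]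
  exact entropy_comp_of_injective μ ((hX.prodMk hY).prodMk hZ) _ <| Equiv.injective _

end entropy

section condEntropy

variable [MeasurableSpace T]

variable {X : Ω → S} {Y : Ω → T}

/-- Conditional entropy of a random variable w.r.t. another.
This is the expectation under the law of `Y` of the entropy of the law of `X` conditioned on the
event `Y = y`. [folklore] -/
noncomputable
def condEntropy (X : Ω → S) (Y : Ω → T) (μ : Measure Ω := by volume_tac) : ℝ :=
  (μ.map Y)[fun y ↦ H[X | Y ← y ; μ]]

/-- `condEntropy_def`: ported from PFR (`PFR/ForMathlib/Entropy/Basic.lean`). [folklore] -/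
lemma condEntropy_def (X : Ω → S) (Y : Ω → T) (μ : Measure Ω) :
    condEntropy X Y μ = (μ.map Y)[fun y ↦ H[X | Y ← y ; μ]] := rfl

@[inherit_doc condEntropy] notation3:max "H[" X " | " Y " ; " μ "]" => condEntropy X Y μ
@[inherit_doc condEntropy] notation3:max "H[" X " | " Y "]" => condEntropy X Y volume

section

variable [MeasurableSingletonClass T]

/-- `condEntropy_eq_zero`: ported from PFR (`PFR/ForMathlib/Entropy/Basic.lean`). [folklore] -/
lemma condEntropy_eq_zero (hY : Measurable Y) (μ : Measure Ω) [IsFiniteMeasure μ] (t : T)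
    (ht : (μ.map Y).real {t} = 0) : H[X | Y ← t ; μ] = 0 := by
  convert entropy_zero_measure X
  apply cond_eq_zero_of_meas_eq_zero
  rw [map_measureReal_apply hY (.singleton t)] at ht
  rw [← measureReal_eq_zero_iff]
  exact ht

/-- Conditional entropy of a random variable is equal to the entropy of its conditional kernel. [folklore] -/
lemma condEntropy_eq_kernel_entropy [Nonempty S] [Countable S] [MeasurableSingletonClass S]
    (hX : Measurable X) (hY : Measurable Y) (μ : Measure Ω) [IsFiniteMeasure μ] [FiniteRange Y] :
    H[X | Y ; μ] = Hk[condDistrib X Y μ, μ.map Y] := by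
  rw [condEntropy_def, Kernel.entropy]
  apply integral_congr_finiteSupport
  intro t ht
  rw [Measure.map_apply hY (.singleton _)] at ht
  simp only [entropy_def]
  congr
  ext s hs
  rw [condDistrib_apply' hX hY _ _ ht hs, Measure.map_apply hX hs,
      cond_apply (hY (.singleton _))]

variable [Countable T] [Nonempty T] [Nonempty S] [MeasurableSingletonClass S] [Countable S]
  [Countable U] [MeasurableSingletonClass U]

/-- `condEntropy_two_eq_kernel_entropy`: ported from PFR (`PFR/ForMathlib/Entropy/Basic.lean`). [folklore] -/
lemma condEntropy_two_eq_kernel_entropy (hX : Measurable X) (hY : Measurable Y) (hZ : Measurable Z)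
    (μ : Measure Ω) [IsProbabilityMeasure μ] [FiniteRange Y] [FiniteRange Z] :
    H[X | ⟨Y, Z⟩ ; μ] =
      Hk[Kernel.condKernel (condDistrib (fun a ↦ (Y a, X a)) Z μ),
        Measure.map Z μ ⊗ₘ Kernel.fst (condDistrib (fun a ↦ (Y a, X a)) Z μ)] := by
  rw [Measure.compProd_congr (condDistrib_fst_ae_eq hY hX hZ μ),
      map_compProd_condDistrib hY hZ,
      Kernel.entropy_congr (condKernel_condDistrib_ae_eq hY hX hZ μ),
      ← Kernel.entropy_congr (swap_condDistrib_ae_eq hY hX hZ μ)]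
  have : μ.map (fun ω ↦ (Z ω, Y ω)) = (μ.map (fun ω ↦ (Y ω, Z ω))).comap Prod.swap := by
    rw [map_prod_comap_swap hY hZ]
  rw [this, condEntropy_eq_kernel_entropy hX (hY.prodMk hZ), Kernel.entropy_comap_swap]

end

/-- Any random variable on a zero measure space has zero conditional entropy. [folklore] -/
@[simp]
lemma condEntropy_zero_measure (X : Ω → S) (Y : Ω → T) : H[X | Y ; (0 : Measure Ω)] = 0 :=
  by simp [condEntropy]

/-- Conditional entropy is non-negative. [folklore] -/
lemma condEntropy_nonneg (X : Ω → S) (Y : Ω → T) (μ : Measure Ω) : 0 ≤ H[X | Y ; μ] :=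
  integral_nonneg (fun _ ↦ measureEntropy_nonneg _)

/-- Conditional entropy is at most the logarithm of the cardinality of the range. [folklore] -/
lemma condEntropy_le_log_card [MeasurableSingletonClass S] [Fintype S]
    (X : Ω → S) (Y : Ω → T) (hY : Measurable Y) (μ : Measure Ω) [IsProbabilityMeasure μ] :
    H[X | Y ; μ] ≤ log (Fintype.card S) := by
  refine (integral_mono_of_nonneg ?_ (integrable_const (log (Fintype.card S))) ?_).trans ?_
  · exact ae_of_all _ (fun _ ↦ entropy_nonneg _ _)
  · exact ae_of_all _ (fun _ ↦ entropy_le_log_card _ _)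
  · have : IsProbabilityMeasure (μ.map Y) := isProbabilityMeasure_map hY.aemeasurable
    simp

/-- `H[X|Y] = ∑_y P[Y=y] H[X|Y=y]`. [folklore] -/
lemma condEntropy_eq_sum [MeasurableSingletonClass T] (X : Ω → S) (Y : Ω → T) (μ : Measure Ω)
    [IsFiniteMeasure μ] (hY : Measurable Y) [FiniteRange Y] :
    H[X | Y ; μ] = ∑ y ∈ FiniteRange.toFinset Y, ((μ.map Y).real {y}) * H[X | Y ← y ; μ] := by
  rw [condEntropy_def, integral_eq_setIntegral (ae_mem_of_finiteRange hY),
    setIntegral_finset _ .finset]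
  simp_rw [smul_eq_mul]

/-- `H[X|Y] = ∑_y P[Y=y] H[X|Y=y]`. [folklore] -/
lemma condEntropy_eq_sum_fintype
    [MeasurableSingletonClass T] (X : Ω → S) (Y : Ω → T) (μ : Measure Ω)
    [IsFiniteMeasure μ] (hY : Measurable Y) [Fintype T] :
    H[X | Y ; μ] = ∑ y, μ.real (Y ⁻¹' {y}) * H[X | Y ← y ; μ] := by
  rw [condEntropy_def, integral_fintype .of_finite]
  simp_rw [smul_eq_mul, map_measureReal_apply hY (.singleton _)]

variable [MeasurableSingletonClass T]

/-- `condEntropy_prod_eq_sum`: ported from PFR (`PFR/ForMathlib/Entropy/Basic.lean`). [folklore] -/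
lemma condEntropy_prod_eq_sum {X : Ω → S} {Y : Ω → T} {Z : Ω → T'} [MeasurableSpace T']
    [MeasurableSingletonClass T']
    (μ : Measure Ω) (hY : Measurable Y) (hZ : Measurable Z)
    [IsFiniteMeasure μ] [Finite T] [Fintype T'] :
    H[X | ⟨Y, Z⟩ ; μ] = ∑ z, μ.real (Z ⁻¹' {z}) * H[X | Y ; μ[|Z ⁻¹' {z}]] := by
  cases nonempty_fintype T
  simp_rw [condEntropy_eq_sum_fintype _ _ _ (hY.prodMk hZ), condEntropy_eq_sum_fintype _ _ _ hY,
    Fintype.sum_prod_type_right, Finset.mul_sum, ← mul_assoc]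
  congr with y
  congr with x
  have A : (fun a ↦ (Y a, Z a)) ⁻¹' {(x, y)} = Z ⁻¹' {y} ∩ Y ⁻¹' {x} := by
    ext p; simp [and_comm]
  congr 2
  · rw [cond_real_apply (hZ (.singleton y)), A]
    obtain hy | hy := eq_or_ne (μ.real (Z ⁻¹' {y})) 0
    · have : μ.real (Z ⁻¹' {y} ∩ Y ⁻¹' {x}) = 0 :=
        measureReal_mono_null Set.inter_subset_left hy (by finiteness)
      simp [this, hy]
    · rw [mul_inv_cancel_left₀ hy]
  · rw [A, cond_cond_eq_cond_inter (hZ (.singleton y)) (hY (.singleton x))]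

variable [MeasurableSingletonClass S]

/-- `H[X|Y] = ∑_y ∑_x P[Y=y] P[X=x|Y=y] log ⧸(P[X=x|Y=y])`$. [folklore] -/
lemma condEntropy_eq_sum_sum (hX : Measurable X) {Y : Ω → T} (hY : Measurable Y)
    (μ : Measure Ω) [IsProbabilityMeasure μ] [FiniteRange X] [FiniteRange Y] :
    H[X | Y ; μ]
      = ∑ y ∈ FiniteRange.toFinset Y, ∑ x ∈ FiniteRange.toFinset X,
        ((μ.map Y).real {y}) * negMulLog (((μ[|Y ← y]).map X).real {x}) := by
  rw [condEntropy_eq_sum _ _ _ hY]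
  congr with y
  rw [entropy_cond_eq_sum_finiteRange hX, Finset.mul_sum]

omit [MeasurableSingletonClass S] in
/-- `H[X|Y] = ∑_y ∑_x P[Y=y] P[X=x|Y=y] log ⧸(P[X=x|Y=y])`$. [folklore] -/
lemma condEntropy_eq_sum_sum_fintype {Y : Ω → T} (hY : Measurable Y)
    (μ : Measure Ω) [IsProbabilityMeasure μ] [Fintype S] [Fintype T] :
    H[X | Y ; μ] = ∑ y, ∑ x, (μ.map Y).real {y} * negMulLog (((μ[|Y ← y]).map X).real {x}) := by
  rw [condEntropy_eq_sum_fintype _ _ _ hY]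
  congr with y
  rw [entropy_cond_eq_sum, tsum_fintype, Finset.mul_sum, map_measureReal_apply hY (.singleton _)]

/-- Same as previous lemma, but with a sum over a product space rather than a double sum. [folklore] -/
lemma condEntropy_eq_sum_prod (hX : Measurable X) {Y : Ω → T}
    (hY : Measurable Y)
    (μ : Measure Ω) [IsProbabilityMeasure μ] [FiniteRange X] [FiniteRange Y] :
    H[X | Y ; μ] = ∑ p ∈ (FiniteRange.toFinset X) ×ˢ (FiniteRange.toFinset Y),
      (μ.map Y).real {p.2} * negMulLog (((μ[|Y ⁻¹' {p.2}]).map X).real {p.1}) := by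
  rw [condEntropy_eq_sum_sum hX hY, Finset.sum_product_right]

variable [Countable S]

/-- If `X : Ω → S`, `Y : Ω → T` are random variables, and `f : T × S → U` is
  injective for each fixed `t ∈ T`, then `H[f(Y, X) | Y] = H[X | Y]`.
  Thus for instance `H[X-Y|Y] = H[X|Y]`. [folklore] -/
lemma condEntropy_of_injective
    [MeasurableSingletonClass U] (μ : Measure Ω) [IsFiniteMeasure μ] (hX : Measurable X)
    (hY : Measurable Y) (f : T → S → U) (hf : ∀ t, Injective (f t)) [FiniteRange Y] :
    H[(fun ω ↦ f (Y ω) (X ω)) | Y ; μ] = H[X | Y ; μ] := by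
  rw [condEntropy_eq_sum _ _ _ hY, condEntropy_eq_sum _ _ _ hY]
  have : ∀ y, H[fun ω ↦ f (Y ω) (X ω)|Y← y; μ] = H[(f y ∘ X) | Y ← y ; μ] := by
    intro y
    refine entropy_congr ?_
    have : ∀ᵐ ω ∂μ[|Y ← y], Y ω = y := by
      rw [ae_iff, cond_apply (hY (.singleton _))]
      have : {a | ¬Y a = y} = (Y ⁻¹' {y})ᶜ := by ext; simp
      rw [this, Set.inter_compl_self, measure_empty, mul_zero]
    filter_upwards [this] with ω hω
    rw [hω]
    simp
  simp_rw [this]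
  congr with y
  rw [entropy_comp_of_injective _ hX (f y) (hf y)]

/-- A weaker version of the above lemma in which `f` is independent of `Y`. [folklore] -/
lemma condEntropy_comp_of_injective {Y : Ω → U}
    (μ : Measure Ω) (hX : Measurable X) (f : S → T) (hf : Injective f) :
    H[f ∘ X | Y ; μ] = H[X | Y ; μ] :=
  integral_congr_ae (ae_of_all _ (fun _ ↦ entropy_comp_of_injective _ hX f hf))

/-- `H[X, Y| Z] = H[Y, X| Z]`. [folklore] -/
lemma condEntropy_comm [Countable T] {Z : Ω → U}
    (hX : Measurable X) (hY : Measurable Y) (μ : Measure Ω) :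
    H[⟨X, Y⟩ | Z ; μ] = H[⟨Y, X⟩ | Z; μ] := by
  change H[⟨X, Y⟩ | Z ; μ] = H[Prod.swap ∘ ⟨X, Y⟩ | Z; μ]
  exact (condEntropy_comp_of_injective μ (hX.prodMk hY) Prod.swap Prod.swap_injective).symm

end condEntropy

section pair

variable [MeasurableSpace T]
variable [Countable S] [MeasurableSingletonClass S]
  [Countable T] [MeasurableSingletonClass T]

/-- One form of the chain rule : `H[X, Y] = H[X] + H[Y | X]`. [folklore] -/
lemma chain_rule' (μ : Measure Ω) [IsZeroOrProbabilityMeasure μ]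
    (hX : Measurable X) (hY : Measurable Y) [FiniteRange X] [FiniteRange Y] :
    H[⟨X, Y⟩ ; μ] = H[X ; μ] + H[Y | X ; μ] := by
  rcases eq_zero_or_isProbabilityMeasure μ with rfl | hμ
  · simp
  have : Nonempty T := Nonempty.map Y (μ.nonempty_of_neZero)
  rw [entropy_eq_kernel_entropy, Kernel.chain_rule]
  · simp_rw [← Kernel.map_const _ (hX.prodMk hY), Kernel.fst_map_prod _ hY, Kernel.map_const _ hX,
      Kernel.map_const _ (hX.prodMk hY)]
    congr 1
    · rw [Kernel.entropy, integral_dirac]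
      rfl
    · simp_rw [condEntropy_eq_kernel_entropy hY hX]
      have : Measure.dirac () ⊗ₘ Kernel.const Unit (μ.map X) = μ.map (fun ω ↦ ((), X ω)) := by
        ext s _
        rw [Measure.dirac_unit_compProd_const, Measure.map_map measurable_prodMk_left hX]
        congr
      rw [this, Kernel.entropy_congr (condDistrib_const_unit hX hY μ)]
      have : μ.map (fun ω ↦ ((), X ω)) = (μ.map X).map (Prod.mk ()) := by
        ext s _
        rw [Measure.map_map measurable_prodMk_left hX]
        rfl
      rw [this, Kernel.entropy_prodMkLeft_unit]
  · apply Kernel.FiniteKernelSupport.aefiniteKernelSupport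
    exact Kernel.finiteKernelSupport_of_const _

/-- Another form of the chain rule : `H[X, Y] = H[Y] + H[X | Y]`. [folklore] -/
lemma chain_rule (μ : Measure Ω) [IsZeroOrProbabilityMeasure μ]
    (hX : Measurable X) (hY : Measurable Y) [FiniteRange X] [FiniteRange Y] :
    H[⟨X, Y⟩ ; μ] = H[Y ; μ] + H[X | Y ; μ] := by
  rw [entropy_comm hX hY, chain_rule' μ hY hX]

/-- Another form of the chain rule : `H[X | Y] = H[X, Y] - H[Y]`. [folklore] -/
lemma chain_rule'' (μ : Measure Ω) [IsZeroOrProbabilityMeasure μ]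
    (hX : Measurable X) (hY : Measurable Y) [FiniteRange X] [FiniteRange Y] :
    H[X | Y ; μ] = H[⟨X, Y⟩ ; μ] - H[Y ; μ] := by
  rw [chain_rule μ hX hY, add_sub_cancel_left]

open ProbabilityTheory.IdentDistrib in
/-- Two pairs of variables that have the same joint distribution, have the same
conditional entropy. [folklore] -/
lemma _root_.ProbabilityTheory.IdentDistrib.condEntropy_eq {Ω' : Type*} [MeasurableSpace Ω'] {X : Ω → S} {Y : Ω → T}
    {μ' : Measure Ω'} {X' : Ω' → S} {Y' : Ω' → T} [IsProbabilityMeasure μ] [IsProbabilityMeasure μ']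
    (hX : Measurable X) (hY : Measurable Y) (hX' : Measurable X') (hY' : Measurable Y')
    (h : IdentDistrib (⟨X, Y⟩) (⟨X', Y'⟩) μ μ') [FiniteRange X] [FiniteRange Y] [FiniteRange X']
    [FiniteRange Y'] :
    H[X | Y ; μ] = H[X' | Y' ; μ'] := by
  have : IdentDistrib Y Y' μ μ' := h.comp measurable_snd
  rw [chain_rule'' _ hX hY, chain_rule'' _ hX' hY', h.entropy_congr, this.entropy_congr]

variable [Countable U] [MeasurableSingletonClass U]

/-- If `X : Ω → S` and `Y : Ω → T` are random variables, and `f : T → U` is an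
injection then `H[X | f(Y)] = H[X | Y]`. [folklore] -/
lemma condEntropy_of_injective' (μ : Measure Ω)
    [IsZeroOrProbabilityMeasure μ] (hX : Measurable X) (hY : Measurable Y) (f : T → U)
    (hf : Injective f)
    (hfY : Measurable (f ∘ Y)) [FiniteRange X] [FiniteRange Y] :
    H[X | f ∘ Y ; μ] = H[X | Y ; μ] := by
  rw [chain_rule'' μ hX hY, chain_rule'' μ hX hfY, chain_rule' μ hX hY, chain_rule' μ hX hfY]
  congr 1
  · congr 1
    exact condEntropy_comp_of_injective μ hY f hf
  exact entropy_comp_of_injective μ hY f hf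

/-- `H[X | f(X)] = H[X] - H[f(X)]`. [folklore] -/
lemma condEntropy_comp_self [IsProbabilityMeasure μ] (hX : Measurable X) {f : S → U}
    (hf : Measurable f) [FiniteRange X] : H[X | f ∘ X ; μ] = H[X ; μ] - H[f ∘ X ; μ] := by
  rw [chain_rule'' μ hX (hf.comp hX), entropy_prod_comp hX _ f]

/-- If `X : Ω → S`, `Y : Ω → T`, `Z : Ω → U` are random variables,
then `H[X, Y | Z] = H[X | Z] + H[Y|X, Z]`. [folklore] -/
lemma cond_chain_rule' (μ : Measure Ω) [IsZeroOrProbabilityMeasure μ]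
    (hX : Measurable X) (hY : Measurable Y) (hZ : Measurable Z)
    [FiniteRange X] [FiniteRange Y] [FiniteRange Z] :
    H[⟨X, Y⟩ | Z ; μ] = H[X | Z ; μ] + H[Y | ⟨X, Z⟩ ; μ] := by
  rcases eq_zero_or_isProbabilityMeasure μ with rfl | hμ
  · simp
  have : Nonempty S := Nonempty.map X (μ.nonempty_of_neZero)
  have : Nonempty T := Nonempty.map Y (μ.nonempty_of_neZero)
  rw [condEntropy_eq_kernel_entropy (hX.prodMk hY) hZ, Kernel.chain_rule]
  · congr 1
    · rw [condEntropy_eq_kernel_entropy hX hZ]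
      refine Kernel.entropy_congr ?_
      exact condDistrib_fst_ae_eq hX hY hZ μ
    · rw [condEntropy_two_eq_kernel_entropy hY hX hZ]
  exact Kernel.aefiniteKernelSupport_condDistrib _ _ μ (by measurability) (by measurability)

/-- `H[X, Y | Z] = H[Y | Z] + H[X | Y, Z]`. [folklore] -/
lemma cond_chain_rule (μ : Measure Ω) [IsZeroOrProbabilityMeasure μ]
    (hX : Measurable X) (hY : Measurable Y) (hZ : Measurable Z) [FiniteRange X] [FiniteRange Y]
    [FiniteRange Z] :
    H[⟨X, Y⟩ | Z ; μ] = H[Y | Z ; μ] + H[X | ⟨Y, Z⟩ ; μ] := by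
  rw [condEntropy_comm hX hY, cond_chain_rule' _ hY hX hZ]

/-- Data-processing inequality for the entropy: `H[f(X)] ≤ H[X]`.
To upgrade this to equality, see `entropy_of_comp_eq_of_comp` or `entropy_comp_of_injective`. [folklore] -/
lemma entropy_comp_le (μ : Measure Ω) [IsZeroOrProbabilityMeasure μ]
    (hX : Measurable X) (f : S → U) [FiniteRange X] :
    H[f ∘ X ; μ] ≤ H[X ; μ] := by
  have hfX : Measurable (f ∘ X) := by fun_prop
  have : H[X ; μ] = H[⟨X, f ∘ X⟩ ; μ] := by
    refine (entropy_comp_of_injective μ hX (fun x ↦ (x, f x)) ?_).symm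
    intro x y hxy
    simp only [Prod.mk.injEq] at hxy
    exact hxy.1
  rw [this, chain_rule _ hX hfX]
  simp only [le_add_iff_nonneg_right]
  exact condEntropy_nonneg X (f ∘ X) μ

/-- A Schroder-Bernstein type theorem for entropy : if two random variables are functions of each
  other, then they have the same entropy. Can be used as a substitute for
  `entropy_comp_of_injective` if one doesn't want to establish the injectivity. [folklore] -/
lemma entropy_of_comp_eq_of_comp
    (μ : Measure Ω) [IsZeroOrProbabilityMeasure μ] (hX : Measurable X) (hY : Measurable Y)
    (f : S → T) (g : T → S) (h1 : Y = f ∘ X) (h2 : X = g ∘ Y) [FiniteRange X] [FiniteRange Y] :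
    H[X ; μ] = H[Y ; μ] := by
  have h3 : H[X ; μ] ≤ H[Y ; μ] := by
    rw [h2]; exact entropy_comp_le μ hY _
  have h4 : H[Y ; μ] ≤ H[X ; μ] := by
    rw [h1]; exact entropy_comp_le μ hX _
  linarith

end pair

section mutualInfo

variable [MeasurableSpace T]

/-- The mutual information `I[X : Y]` of two random variables
is defined to be `H[X] + H[Y] - H[X ; Y]`. [folklore] -/
noncomputable
def mutualInfo (X : Ω → S) (Y : Ω → T) (μ : Measure Ω := by volume_tac) : ℝ :=
  H[X ; μ] + H[Y ; μ] - H[⟨X, Y⟩ ; μ]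

@[inherit_doc mutualInfo] notation3:max "I[" X " : " Y " ; " μ "]" => mutualInfo X Y μ
@[inherit_doc mutualInfo] notation3:max "I[" X " : " Y "]" => mutualInfo X Y volume

/-- `mutualInfo_def`: ported from PFR (`PFR/ForMathlib/Entropy/Basic.lean`). [folklore] -/
lemma mutualInfo_def (X : Ω → S) (Y : Ω → T) (μ : Measure Ω) :
  I[X : Y ; μ] = H[X ; μ] + H[Y ; μ] - H[⟨X, Y⟩ ; μ] := rfl

/-- `entropy_add_entropy_sub_mutualInfo`: ported from PFR (`PFR/ForMathlib/Entropy/Basic.lean`). [folklore] -/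
lemma entropy_add_entropy_sub_mutualInfo (X : Ω → S) (Y : Ω → T) (μ : Measure Ω) :
    H[X ; μ] + H[Y ; μ] - I[X : Y ; μ] = H[⟨X, Y⟩ ; μ] := sub_sub_self _ _

open ProbabilityTheory.IdentDistrib in
/-- Substituting variables for ones with the same distributions doesn't change the mutual
information. [folklore] -/
lemma _root_.ProbabilityTheory.IdentDistrib.mutualInfo_eq {Ω' : Type*} [MeasurableSpace Ω'] {μ' : Measure Ω'}
    {X' : Ω' → S} {Y' : Ω' → T} (hXY : IdentDistrib (⟨X, Y⟩) (⟨X', Y'⟩) μ μ') :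
      I[X : Y ; μ] = I[X' : Y' ; μ'] := by
  have hX : IdentDistrib X X' μ μ' := hXY.comp measurable_fst
  have hY : IdentDistrib Y Y' μ μ' := hXY.comp measurable_snd
  simp_rw [mutualInfo_def,hX.entropy_congr,hY.entropy_congr,hXY.entropy_congr]

/-- The conditional mutual information `I[X : Y| Z]` is the mutual information of `X| Z=z` and
`Y| Z=z`, integrated over `z`. [folklore] -/
noncomputable
def condMutualInfo (X : Ω → S) (Y : Ω → T) (Z : Ω → U) (μ : Measure Ω := by volume_tac) :
    ℝ := (μ.map Z)[fun z ↦ H[X | Z ← z ; μ] + H[Y | Z ← z ; μ] - H[⟨X, Y⟩ | Z ← z ; μ]]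

/-- `condMutualInfo_def`: ported from PFR (`PFR/ForMathlib/Entropy/Basic.lean`). [folklore] -/
lemma condMutualInfo_def (X : Ω → S) (Y : Ω → T) (Z : Ω → U) (μ : Measure Ω) :
    condMutualInfo X Y Z μ = (μ.map Z)[fun z ↦
      H[X | Z ← z ; μ] + H[Y | Z ← z ; μ] - H[⟨X, Y⟩ | Z ← z ; μ]] := rfl

@[inherit_doc condMutualInfo]
notation3:max "I[" X " : " Y "|" Z ";" μ "]" => condMutualInfo X Y Z μ
@[inherit_doc condMutualInfo]
notation3:max "I[" X " : " Y "|" Z "]" => condMutualInfo X Y Z volume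

/-- `condMutualInfo_eq_integral_mutualInfo`: ported from PFR (`PFR/ForMathlib/Entropy/Basic.lean`). [folklore] -/
lemma condMutualInfo_eq_integral_mutualInfo :
    I[X : Y | Z ; μ] = (μ.map Z)[fun z ↦ I[X : Y ; μ[| Z ⁻¹' {z}]]] := rfl

/-- `condMutualInfo_zero_measure`: ported from PFR (`PFR/ForMathlib/Entropy/Basic.lean`). [folklore] -/
@[simp] lemma condMutualInfo_zero_measure : I[X : Y | Z ; 0] = 0 := by
  simp [condMutualInfo]

section

variable [MeasurableSingletonClass S] [MeasurableSingletonClass T]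

/-- Mutual information is non-negative. [folklore] -/
lemma mutualInfo_nonneg (hX : Measurable X) (hY : Measurable Y) (μ : Measure Ω)
    [FiniteRange X] [FiniteRange Y] :
    0 ≤ I[X : Y ; μ] := by
  simp_rw [mutualInfo_def, entropy_def]
  have h_fst : μ.map X = (μ.map (⟨X, Y⟩)).map Prod.fst := by
    rw [Measure.map_map measurable_fst (hX.prodMk hY)]
    congr
  have h_snd : μ.map Y = (μ.map (⟨X, Y⟩)).map Prod.snd := by
    rw [Measure.map_map measurable_snd (hX.prodMk hY)]
    congr
  rw [h_fst, h_snd]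
  exact measureMutualInfo_nonneg

/-- Subadditivity of entropy. [folklore] -/
lemma entropy_pair_le_add (hX : Measurable X) (hY : Measurable Y) (μ : Measure Ω) [FiniteRange X]
    [FiniteRange Y] : H[⟨X, Y⟩ ; μ] ≤ H[X ; μ] + H[Y ; μ] :=
  sub_nonneg.1 <| mutualInfo_nonneg hX hY _

/-- `I[X : Y] = 0` iff `X, Y` are independent. [folklore] -/
lemma mutualInfo_eq_zero (hX : Measurable X) (hY : Measurable Y) {μ : Measure Ω}
    [IsZeroOrProbabilityMeasure μ] [FiniteRange X] [FiniteRange Y] :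
    I[X : Y ; μ] = 0 ↔ IndepFun X Y μ := by
  simp_rw [mutualInfo_def, entropy_def]
  have h_fst : μ.map X = (μ.map (⟨X, Y⟩)).map Prod.fst := by
    rw [Measure.map_map measurable_fst (hX.prodMk hY)]
    congr
  have h_snd : μ.map Y = (μ.map (⟨X, Y⟩)).map Prod.snd := by
    rw [Measure.map_map measurable_snd (hX.prodMk hY)]
    congr
  rw [h_fst, h_snd, ← measureMutualInfo.eq_def, measureMutualInfo_eq_zero_iff]
  simp [indepFun_iff_map_prod_eq_prod_map_map hX.aemeasurable hY.aemeasurable,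
    ext_iff_measureReal_singleton_finiteSupport,
    Measure.map_map measurable_fst (hX.prodMk hY),
    Measure.map_map measurable_snd (hX.prodMk hY), ← measureReal_prod_prod, Function.comp_def]

protected alias ⟨_, _root_.ProbabilityTheory.IndepFun.mutualInfo_eq_zero⟩ := mutualInfo_eq_zero

/-- The mutual information with a constant is always zero. [folklore] -/
lemma mutualInfo_const (hX : Measurable X) (c : T)
    {μ : Measure Ω} [IsZeroOrProbabilityMeasure μ] [FiniteRange X] :
    I[X : fun _ ↦ c ; μ] = 0 :=
  (indepFun_const_right _ c).mutualInfo_eq_zero hX measurable_const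

/-- `H[X, Y] = H[X] + H[Y]` if and only if `X, Y` are independent. [folklore] -/
lemma entropy_pair_eq_add (hX : Measurable X) (hY : Measurable Y) {μ : Measure Ω}
    [IsZeroOrProbabilityMeasure μ] [FiniteRange X] [FiniteRange Y] :
    H[⟨X, Y⟩ ; μ] = H[X ; μ] + H[Y ; μ] ↔ IndepFun X Y μ := by
  rw [eq_comm, ← sub_eq_zero, ← mutualInfo_eq_zero hX hY]; rfl

/-- If `X, Y` are independent, then `H[X, Y] = H[X] + H[Y]`. -/
protected alias ⟨_, _root_.ProbabilityTheory.IndepFun.entropy_pair_eq_add⟩ := entropy_pair_eq_add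

open ProbabilityTheory.iIndepFun in
/-- `_root_.ProbabilityTheory.iIndepFun.entropy_eq_add`: ported from PFR (`PFR/ForMathlib/Entropy/Basic.lean`). [folklore] -/
lemma _root_.ProbabilityTheory.iIndepFun.entropy_eq_add {Ω S : Type*} [hΩ: MeasureSpace Ω] [IsProbabilityMeasure hΩ.volume]
    {m : ℕ} [MeasurableSpace S] [MeasurableSingletonClass S] [Finite S]
    {X : Fin m → Ω → S} (hX : ∀ i, Measurable (X i)) (h_indep : iIndepFun X) :
    H[(fun ω i ↦ X i ω)] = ∑ i, H[X i] := by
  cases nonempty_fintype S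
  induction m with
  | zero =>
    simp only [Finset.univ_eq_empty, Finset.sum_empty]
    convert entropy_const Fin.elim0 <;> infer_instance
  | succ m hm =>
  calc
    _ = H[ ⟨(fun ω (i:Fin m) ↦ X i.castSucc ω), X (.last _)⟩ ] := by
      let f : (Fin (m + 1) → S) → (Fin m → S) × S := fun x ↦ (fun i ↦ x i.castSucc, x (.last m))
      convert! (entropy_comp_of_injective _ _ f _).symm
      · fun_prop
      intro x y hxy
      simp only [Prod.mk.injEq, f] at hxy
      ext i; rcases Fin.eq_castSucc_or_eq_last i with h | rfl
      · obtain ⟨j, rfl⟩ := h; replace hxy := hxy.1; exact congr($hxy j)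
      tauto
    _ = H[fun ω (i:Fin m) ↦ X i.castSucc ω] + H[X (.last m)] := by
      apply (entropy_pair_eq_add _ _).mpr _ <;> try fun_prop
      let T : Finset (Fin (m + 1)) := {.last m}ᶜ
      let T' : Finset (Fin (m + 1)) := {.last m}
      let φ : (T → S) → (Fin m → S) := fun f j ↦ f ⟨ j.castSucc, by simp [T] ⟩
      let φ' : (T' → S) → S := fun f ↦ f ⟨ .last m, by simp [T'] ⟩
      exact finsets_comp' (by simp [T', T]) h_indep hX (show Measurable φ by fun_prop)
        (show Measurable φ' by fun_prop)
    _ = ∑ i:Fin m, H[X i.castSucc] + H[X (.last m)] := by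
      congr; apply hm _ _
      · intro i; fun_prop
      let T : Fin m → Finset (Fin (m + 1)) := fun i ↦ {i.castSucc}
      let φ : (i:Fin m) → ((_: T i) → S) → S := fun i x ↦ x ⟨ i.castSucc, by simp [T] ⟩
      convert iIndepFun.finsets_comp T _ h_indep hX φ (by fun_prop)
      rw [Finset.pairwiseDisjoint_iff]; rintro ⟨ _, _ ⟩ _ ⟨ _, _ ⟩ _ ⟨ ⟨ _, _ ⟩, hij ⟩
      simp [T] at hij ⊢
      grind
    _ = _ := by rw [Fin.sum_univ_castSucc]

variable [Countable S] [Countable T]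

/-- `I[X : Y] = I[Y : X]`. [folklore] -/
lemma mutualInfo_comm (hX : Measurable X) (hY : Measurable Y) (μ : Measure Ω) :
    I[X : Y ; μ] = I[Y : X ; μ] := by simp_rw [mutualInfo, add_comm, entropy_comm hX hY]

/-- `I[X : Y] = H[X] - H[X|Y]`. [folklore] -/
lemma mutualInfo_eq_entropy_sub_condEntropy
    (hX : Measurable X) (hY : Measurable Y) (μ : Measure Ω)
    [IsZeroOrProbabilityMeasure μ] [FiniteRange X] [FiniteRange Y] :
    I[X : Y ; μ] = H[X ; μ] - H[X | Y ; μ] := by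
  rw [mutualInfo_def, chain_rule μ hX hY]
  abel

/-- `I[X : Y] = H[Y] - H[Y | X]`. [folklore] -/
lemma mutualInfo_eq_entropy_sub_condEntropy' (hX : Measurable X) (hY : Measurable Y) (μ : Measure Ω)
    [IsZeroOrProbabilityMeasure μ] [FiniteRange X] [FiniteRange Y] :
    I[X : Y ; μ] = H[Y ; μ] - H[Y | X ; μ] := by
  rw [mutualInfo_comm hX hY, mutualInfo_eq_entropy_sub_condEntropy hY hX]

/-- `H[X] - I[X : Y] = H[X | Y]`. [folklore] -/
lemma entropy_sub_mutualInfo_eq_condEntropy (hX : Measurable X) (hY : Measurable Y) (μ : Measure Ω)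
    [IsZeroOrProbabilityMeasure μ] [FiniteRange X] [FiniteRange Y] :
    H[X ; μ] - I[X : Y ; μ] = H[X | Y ; μ] := by
  rw [mutualInfo_eq_entropy_sub_condEntropy hX hY, sub_sub_self]

/-- `H[Y] - I[X : Y] = H[Y | X]`. [folklore] -/
lemma entropy_sub_mutualInfo_eq_condEntropy' (hX : Measurable X) (hY : Measurable Y) (μ : Measure Ω)
    [IsZeroOrProbabilityMeasure μ] [FiniteRange X] [FiniteRange Y] :
    H[Y ; μ] - I[X : Y ; μ] = H[Y | X ; μ] := by
  rw [mutualInfo_eq_entropy_sub_condEntropy' hX hY, sub_sub_self]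

open ProbabilityTheory.IndepFun in
/-- `_root_.ProbabilityTheory.IndepFun.condEntropy_eq_entropy`: ported from PFR (`PFR/ForMathlib/Entropy/Basic.lean`). [folklore] -/
lemma _root_.ProbabilityTheory.IndepFun.condEntropy_eq_entropy {μ : Measure Ω} (h : IndepFun X Y μ)
    (hX : Measurable X) (hY : Measurable Y) [IsZeroOrProbabilityMeasure μ]
    [FiniteRange X] [FiniteRange Y] :
    H[X | Y ; μ] = H[X ; μ] := by
  have := h.mutualInfo_eq_zero hX hY
  rw [mutualInfo_eq_entropy_sub_condEntropy hX hY] at this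
  linarith

variable [Countable U] [MeasurableSingletonClass U] [Nonempty S] [Nonempty T]

/-- The conditional mutual information agrees with the information of the conditional kernel.
 [folklore] -/
lemma condMutualInfo_eq_kernel_mutualInfo
    (hX : Measurable X) (hY : Measurable Y) (hZ : Measurable Z)
    (μ : Measure Ω) [IsZeroOrProbabilityMeasure μ] [FiniteRange Z] :
    I[X : Y | Z ; μ] = Ik[condDistrib (⟨X, Y⟩) Z μ, μ.map Z] := by
  rcases finiteSupport_of_finiteRange (μ := μ) (X := Z) with ⟨A, hA⟩
  simp_rw [condMutualInfo_def, entropy_def, Kernel.mutualInfo, Kernel.entropy,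
    integral_eq_setIntegral hA, setIntegral_finset _ .finset, smul_eq_mul, mul_sub,
    mul_add, Finset.sum_sub_distrib, Finset.sum_add_distrib]
  congr with x
  · have h := condDistrib_fst_ae_eq hX hY hZ μ
    rw [Filter.EventuallyEq, ae_iff_of_countable] at h
    specialize h x
    by_cases hx : (μ.map Z) {x} = 0
    · simp [hx, Measure.real]
    rw [h hx, condDistrib_apply hX hZ]
    rwa [Measure.map_apply hZ (.singleton _)] at hx
  · have h := condDistrib_snd_ae_eq hX hY hZ μ
    rw [Filter.EventuallyEq, ae_iff_of_countable] at h
    specialize h x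
    by_cases hx : (μ.map Z) {x} = 0
    · simp [hx, Measure.real]
    rw [h hx, condDistrib_apply hY hZ]
    rwa [Measure.map_apply hZ (.singleton _)] at hx
  · by_cases hx : (μ.map Z) {x} = 0
    · simp [hx, Measure.real]
    rw [condDistrib_apply (hX.prodMk hY) hZ]
    rwa [Measure.map_apply hZ (.singleton _)] at hx

end

/-- `condMutualInfo_eq_sum`: ported from PFR (`PFR/ForMathlib/Entropy/Basic.lean`). [folklore] -/
lemma condMutualInfo_eq_sum [MeasurableSingletonClass U] [IsFiniteMeasure μ]
    (hZ : Measurable Z) [FiniteRange Z] :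
    I[X : Y | Z ; μ] = ∑ z ∈ FiniteRange.toFinset Z,
      μ.real (Z ⁻¹' {z}) * I[X : Y ; μ[|Z ← z]] := by
  rw [condMutualInfo_eq_integral_mutualInfo,
    integral_eq_setIntegral (ae_mem_of_finiteRange hZ),
    setIntegral_finset _ .finset]
  congr 1 with z
  rw [map_measureReal_apply hZ (MeasurableSet.singleton z)]
  rfl

/-- A variant of `condMutualInfo_eq_sum` when `Z` has finite codomain. [folklore] -/
lemma condMutualInfo_eq_sum' [MeasurableSingletonClass U] [IsFiniteMeasure μ]
    (hZ : Measurable Z) [Fintype U] :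
    I[X : Y | Z ; μ] = ∑ z, μ.real (Z ⁻¹' {z}) * I[X : Y ; (μ[|Z ← z])] := by
  rw [condMutualInfo_eq_sum hZ]
  apply Finset.sum_subset
  · simp
  intro z _ hz
  have : Z ⁻¹' {z} = ∅ := by
    ext ω
    simp at hz
    simp [hz]
  simp [this]

section

variable [MeasurableSingletonClass S] [MeasurableSingletonClass T]

/-- Conditional information is non-nonegative. [folklore] -/
lemma condMutualInfo_nonneg (hX : Measurable X) (hY : Measurable Y) {Z : Ω → U} {μ : Measure Ω}
    [FiniteRange X] [FiniteRange Y] :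
    0 ≤ I[X : Y | Z ; μ] := by
  refine integral_nonneg (fun z ↦ ?_)
  exact mutualInfo_nonneg hX hY _

variable [Countable S] [Countable T]

/-- `I[X : Y | Z] = I[Y : X | Z]`. [folklore] -/
lemma condMutualInfo_comm
    (hX : Measurable X) (hY : Measurable Y) (Z : Ω → U) (μ : Measure Ω) :
    I[X : Y | Z ; μ] = I[Y : X | Z ; μ] := by
  simp_rw [condMutualInfo_def, add_comm, entropy_comm hX hY]

variable [MeasurableSingletonClass U]

/-- `I[X : Y| Z] = H[X| Z] + H[Y| Z] - H[X, Y| Z]`. [folklore] -/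
lemma condMutualInfo_eq [Countable U]
    (hX : Measurable X) (hY : Measurable Y) (hZ : Measurable Z)
    (μ : Measure Ω) [IsZeroOrProbabilityMeasure μ] [FiniteRange Z] :
    I[X : Y | Z ; μ] = H[X | Z ; μ] + H[Y | Z; μ] - H[⟨X, Y⟩ | Z ; μ] := by
  rcases eq_zero_or_isProbabilityMeasure μ with rfl | hμ
  · simp
  have : Nonempty S := Nonempty.map X (μ.nonempty_of_neZero)
  have : Nonempty T := Nonempty.map Y (μ.nonempty_of_neZero)
  rw [condMutualInfo_eq_kernel_mutualInfo hX hY hZ, Kernel.mutualInfo,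
    Kernel.entropy_congr (condDistrib_fst_ae_eq hX hY hZ _),
    Kernel.entropy_congr (condDistrib_snd_ae_eq hX hY hZ _),
    condEntropy_eq_kernel_entropy hX hZ, condEntropy_eq_kernel_entropy hY hZ,
    condEntropy_eq_kernel_entropy (hX.prodMk hY) hZ]

/-- `I[X : Y| Z] = H[X| Z] - H[X|Y, Z]`. [folklore] -/
lemma condMutualInfo_eq' [Countable U]
    (hX : Measurable X) (hY : Measurable Y) (hZ : Measurable Z)
    (μ : Measure Ω) [IsZeroOrProbabilityMeasure μ] [FiniteRange X] [FiniteRange Y] [FiniteRange Z] :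
    I[X : Y | Z ; μ] = H[X | Z ; μ] - H[X | ⟨Y, Z⟩ ; μ] := by
  rw [condMutualInfo_eq hX hY hZ, cond_chain_rule _ hX hY hZ]
  ring

/-- If `f(Z, X)` is injective for each fixed `Z`, then `I[f(Z, X) : Y| Z] = I[X : Y| Z]`. [folklore] -/
lemma condMutualInfo_of_inj_map [Countable U] [IsZeroOrProbabilityMeasure μ]
    (hX : Measurable X) (hY : Measurable Y) (hZ : Measurable Z)
    {V : Type*} [MeasurableSpace V] [MeasurableSingletonClass V] [Countable V]
    (f : U → S → V) (hf : ∀ t, Function.Injective (f t)) [FiniteRange Z] :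
    I[fun ω ↦ f (Z ω) (X ω) : Y | Z ; μ] =
    I[X : Y | Z ; μ] := by
  have hM : Measurable (Function.uncurry f ∘ ⟨Z, X⟩) := by fun_prop
  have hM : Measurable fun ω ↦ f (Z ω) (X ω) := hM
  rw [condMutualInfo_eq hM hY hZ, condMutualInfo_eq hX hY hZ]
  let g : U → (S × T) → (V × T) := fun z (x, y) ↦ (f z x, y)
  have hg : ∀ t, Function.Injective (g t) :=
    fun _ _ _ h ↦ Prod.ext_iff.2 ⟨hf _ (Prod.ext_iff.1 h).1, (Prod.ext_iff.1 h).2⟩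
  rw [← condEntropy_of_injective μ (hX.prodMk hY) hZ g hg, ← condEntropy_of_injective μ hX hZ _ hf]

/-- `condMutualInfo_of_inj`: ported from PFR (`PFR/ForMathlib/Entropy/Basic.lean`). [folklore] -/
lemma condMutualInfo_of_inj [Countable U]
    (hX : Measurable X) (hY : Measurable Y) (hZ : Measurable Z)
    (μ : Measure Ω) [IsZeroOrProbabilityMeasure μ] [FiniteRange X] [FiniteRange Y] [FiniteRange Z]
    {V : Type*} [MeasurableSpace V] [MeasurableSingletonClass V] [Countable V]
    {f : U → V} (hf : Function.Injective f) :
    I[X : Y | f ∘ Z; μ] = I[X : Y | Z; μ] := by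
  have hfZ : Measurable (f ∘ Z) := by fun_prop
  rw [condMutualInfo_eq hX hY hZ, condMutualInfo_eq hX hY hfZ,
    condEntropy_of_injective' _ hX hZ _ hf hfZ, condEntropy_of_injective' _ hY hZ _ hf hfZ,
    condEntropy_of_injective' _ (hX.prodMk hY) hZ _ hf hfZ]

/-- `condMutualInfo_of_inj'`: ported from PFR (`PFR/ForMathlib/Entropy/Basic.lean`). [folklore] -/
lemma condMutualInfo_of_inj' {S T U S' T' U' Ω : Type*} [mΩ : MeasurableSpace Ω]
    [MeasurableSpace S] [MeasurableSingletonClass S] [Countable S]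
    [MeasurableSpace T] [MeasurableSingletonClass T] [Countable T]
    [MeasurableSpace U] [MeasurableSingletonClass U] [Countable U]
    [MeasurableSpace S'] [MeasurableSingletonClass S'] [Countable S']
    [MeasurableSpace T'] [MeasurableSingletonClass T'] [Countable T']
    [MeasurableSpace U'] [MeasurableSingletonClass U'] [Countable U']
    {X : Ω → S} {Y : Ω → T} {Z : Ω → U} (hX : Measurable X) (hY : Measurable Y) (hZ : Measurable Z)
    (μ : Measure Ω) [IsZeroOrProbabilityMeasure μ] [FiniteRange X] [FiniteRange Y] [FiniteRange Z]
    {f : S → S'} (hf : Function.Injective f)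
    {g : T → T'} (hg : Function.Injective g)
    {h : U → U'} (hh : Function.Injective h)
    : I[f ∘ X : g ∘ Y | h ∘ Z; μ] = I[X : Y | Z; μ] := calc
    _ = I[f ∘ X : g ∘ Y | Z; μ] := by rw [condMutualInfo_of_inj _ _ _ _ hh] <;> try fun_prop
    _ = I[X : g ∘ Y | Z; μ] := condMutualInfo_of_inj_map hX (by fun_prop) hZ (fun _ ↦ f) fun _ ↦ hf
    _ = I[g ∘ Y : X | Z; μ] := by apply condMutualInfo_comm <;> fun_prop
    _ = I[Y : X | Z; μ] := condMutualInfo_of_inj_map hY (by fun_prop) hZ (fun _ ↦ g) (fun _ ↦ hg)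
    _ = _ := by apply condMutualInfo_comm <;> fun_prop

/-- `condEntropy_prod_eq_of_indepFun`: ported from PFR (`PFR/ForMathlib/Entropy/Basic.lean`). [folklore] -/
lemma condEntropy_prod_eq_of_indepFun [Finite T] [Finite U] [IsZeroOrProbabilityMeasure μ]
    (hX : Measurable X) (hY : Measurable Y) (hZ : Measurable Z) [FiniteRange X]
    (h : IndepFun (⟨X, Y⟩) Z μ) :
    H[X | ⟨Y, Z⟩ ; μ] = H[X | Y ; μ] := by
  cases nonempty_fintype U
  rcases eq_zero_or_isProbabilityMeasure μ with rfl | hμ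
  · simp
  rw [condEntropy_prod_eq_sum _ hY hZ]
  have : H[X | Y ; μ] = ∑ z, (μ.real (Z ⁻¹' {z})) * H[X | Y ; μ] := by
    rw [← Finset.sum_mul, sum_measureReal_preimage_singleton _ fun z _ ↦ hZ <| .singleton z]; simp
  rw [this]
  congr with w
  rcases eq_or_ne (μ (Z ⁻¹' {w})) 0 with hw|hw
  · simp [hw, Measure.real]
  congr 1
  have : IsProbabilityMeasure (μ[|Z ⁻¹' {w}]) := cond_isProbabilityMeasure hw
  apply IdentDistrib.condEntropy_eq hX hY hX hY
  exact (h.identDistrib_cond (MeasurableSet.singleton w) (hX.prodMk hY) hZ hw).symm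

end

section IsProbabilityMeasure

variable [MeasurableSingletonClass S] [MeasurableSingletonClass T]

variable [Countable U] [MeasurableSingletonClass U]

/-- `I[X : Y| Z]=0` iff `X, Y` are conditionally independent over `Z`. [folklore] -/
lemma condMutualInfo_eq_zero (hX : Measurable X) (hY : Measurable Y)
    [IsZeroOrProbabilityMeasure μ] [FiniteRange X] [FiniteRange Y] [FiniteRange Z] :
    I[X : Y | Z ; μ] = 0 ↔ CondIndepFun X Y Z μ := by
  rw [condIndepFun_iff, condMutualInfo_eq_integral_mutualInfo, integral_eq_zero_iff_of_nonneg]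
  · have : (fun x ↦ I[X : Y;μ[| Z ⁻¹' {x}]]) =ᵐ[μ.map Z] 0 ↔
      ∀ᵐ z ∂(μ.map Z), I[X : Y ; μ[| Z ⁻¹' {z}]] = 0 := by rfl
    rw [this]
    apply Filter.eventually_congr
    rw [ae_iff_of_countable]
    intro z _hz
    exact mutualInfo_eq_zero hX hY
  · intro z
    by_cases hz : μ (Z ⁻¹' {z}) = 0
    · simp [cond_eq_zero_of_meas_eq_zero hz, mutualInfo_def]
    · exact mutualInfo_nonneg hX hY _
  · exact integrable_of_finiteSupport _

variable (μ)
variable [Countable S] [Countable T]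

/-- If `X, Y` are conditionally independent over `Z`, then `H[X, Y, Z] = H[X, Z] + H[Y, Z] - H[Z]`.
 [folklore] -/
lemma ent_of_cond_indep (hX : Measurable X) (hY : Measurable Y) (hZ : Measurable Z)
     (h : CondIndepFun X Y Z μ) [IsZeroOrProbabilityMeasure μ]
     [FiniteRange X] [FiniteRange Y] [FiniteRange Z] :
     H[⟨X, ⟨Y, Z⟩⟩ ; μ] = H[⟨X, Z⟩; μ] + H[⟨Y, Z⟩; μ] - H[Z; μ] := by
  have hI : I[X : Y | Z ; μ] = 0 := (condMutualInfo_eq_zero hX hY).mpr h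
  rw [condMutualInfo_eq hX hY hZ] at hI
  rw [entropy_assoc hX hY hZ, chain_rule _ (hX.prodMk hY) hZ, chain_rule _ hX hZ,
    chain_rule _ hY hZ]
  linarith [hI]

variable [IsZeroOrProbabilityMeasure μ]

/-- `H[X] - H[X|Y] = I[X : Y]` [folklore] -/
lemma entropy_sub_condEntropy (hX : Measurable X) (hY : Measurable Y) [FiniteRange X]
    [FiniteRange Y] : H[X ; μ] - H[X | Y ; μ] = I[X : Y ; μ] := by
  rw [mutualInfo_def, chain_rule _ hX hY, add_comm, add_sub_add_left_eq_sub]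

/-- `H[X | Y] ≤ H[X]`. [folklore] -/
lemma condEntropy_le_entropy (hX : Measurable X) (hY : Measurable Y) [FiniteRange X]
    [FiniteRange Y] : H[X | Y ; μ] ≤ H[X ; μ] :=
  sub_nonneg.1 <| by rw [entropy_sub_condEntropy _ hX hY]; exact mutualInfo_nonneg hX hY _

/-- `H[X | Y, Z] ≤ H[X | Z]`. [folklore] -/
lemma entropy_submodular (hX : Measurable X) (hY : Measurable Y) (hZ : Measurable Z)
    [FiniteRange X] [FiniteRange Y] [FiniteRange Z] :
    H[X | ⟨Y, Z⟩ ; μ] ≤ H[X | Z ; μ] := by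
  rcases eq_zero_or_isProbabilityMeasure μ with rfl | hμ
  · simp
  have : Nonempty S := Nonempty.map X (μ.nonempty_of_neZero)
  have : Nonempty T := Nonempty.map Y (μ.nonempty_of_neZero)
  rw [condEntropy_eq_kernel_entropy hX hZ, condEntropy_two_eq_kernel_entropy hX hY hZ]
  refine (Kernel.entropy_condKernel_le_entropy_snd ?_).trans_eq ?_
  · apply Kernel.aefiniteKernelSupport_condDistrib
    all_goals fun_prop
  exact Kernel.entropy_congr (condDistrib_snd_ae_eq hY hX hZ _)

/-- Data-processing inequality for the conditional entropy: `H[Y|f(X)] ≥ H[Y|X]`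
To upgrade this to equality, see `condEntropy_of_injective'` [folklore] -/
lemma condEntropy_comp_ge
    [FiniteRange X] [FiniteRange Y] (μ : Measure Ω) [IsZeroOrProbabilityMeasure μ]
    (hX : Measurable X) (hY : Measurable Y) (f : S → U) : H[Y | f ∘ X ; μ] ≥ H[Y | X; μ] := by
  have h_joint : H[⟨Y, ⟨X, f ∘ X⟩⟩ ; μ] = H[⟨Y, X⟩ ; μ] := by
    let g : T × S → T × S × U := fun (y, x) ↦ (y, (x, f x))
    change H[g ∘ ⟨Y, X⟩ ; μ] = H[⟨Y, X⟩ ; μ]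
    refine entropy_comp_of_injective μ (by exact Measurable.prod hY hX) g (fun _ _ h => ?_)
    repeat rewrite [Prod.mk.injEq] at h
    exact Prod.ext h.1 h.2.1
  have hZ : Measurable (f ∘ X) := by fun_prop
  rewrite [chain_rule'' μ hY hX, ← entropy_prod_comp hX μ f, ← h_joint,
    ← chain_rule'' μ hY (Measurable.prod (by exact hX) (by exact hZ))]
  exact entropy_submodular μ hY hX hZ

/-- The submodularity inequality: `H[X, Y, Z] + H[Z] ≤ H[X, Z] + H[Y, Z]`. [folklore] -/
lemma entropy_triple_add_entropy_le (hX : Measurable X) (hY : Measurable Y) (hZ : Measurable Z)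
    [FiniteRange X] [FiniteRange Y] [FiniteRange Z] :
    H[⟨X, ⟨Y, Z⟩⟩ ; μ] + H[Z ; μ] ≤ H[⟨X, Z⟩ ; μ] + H[⟨Y, Z⟩ ; μ] := by
  rw [chain_rule _ hX (hY.prodMk hZ), chain_rule _ hX hZ, chain_rule _ hY hZ]
  ring_nf
  exact add_le_add le_rfl (entropy_submodular _ hX hY hZ)

end IsProbabilityMeasure
end mutualInfo
end Literature.Combinatorics.Additive.PFR

section dataProcessing

open Function MeasureTheory Measure Real
open scoped ENNReal NNReal Topology ProbabilityTheory

namespace Literature.Combinatorics.Additive.PFR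
open scoped ProbabilityTheory
open ProbabilityTheory

universe uΩ uS uT uU uV uW

variable {Ω : Type uΩ} {S : Type uS} {T : Type uT} {U : Type uU} {V : Type uV} {W : Type uW}
  [mΩ : MeasurableSpace Ω] [MeasurableSpace S] [MeasurableSpace T] [MeasurableSpace U]
  [MeasurableSpace V] [MeasurableSpace W]
  [Countable S] [Countable T] [Countable V] [Countable W]
  [MeasurableSingletonClass S] [MeasurableSingletonClass T] [MeasurableSingletonClass U]
  [MeasurableSingletonClass V] [MeasurableSingletonClass W]
  {X : Ω → S} {Y : Ω → T} {Z : Ω → U}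
  {μ : Measure Ω}

/--
Let `X, Y`be random variables. For any function `f, g` on the range of `X`, we have
`I[f(X) : Y] ≤ I[X : Y]`.
 [folklore] -/
lemma mutual_comp_le [Countable U] (μ : Measure Ω) [IsProbabilityMeasure μ] (hX : Measurable X)
    (hY : Measurable Y) (f : S → U) [FiniteRange X] [FiniteRange Y] :
    I[f ∘ X : Y ; μ] ≤ I[X : Y ; μ] := by
  have h_meas : Measurable (f ∘ X) := by fun_prop
  rw [mutualInfo_comm h_meas hY, mutualInfo_comm hX hY,
    mutualInfo_eq_entropy_sub_condEntropy hY h_meas, mutualInfo_eq_entropy_sub_condEntropy hY hX]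
  gcongr
  exact condEntropy_comp_ge μ hX hY f

/-- Let `X, Y` be random variables. For any functions `f, g` on the ranges of `X, Y` respectively,
we have `I[f ∘ X : g ∘ Y ; μ] ≤ I[X : Y ; μ]`. [folklore] -/
lemma mutual_comp_comp_le [Countable U] (μ : Measure Ω) [IsProbabilityMeasure μ] (hX : Measurable X)
    (hY : Measurable Y) (f : S → U) (g : T → V) (hg : Measurable g)
    [FiniteRange X] [FiniteRange Y] :
    I[f ∘ X : g ∘ Y ; μ] ≤ I[X : Y ; μ] :=
  calc
    _ ≤ I[X : g ∘ Y ; μ] := mutual_comp_le μ hX (Measurable.comp hg hY) f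
    _ = I[g ∘ Y : X ; μ] := mutualInfo_comm hX (Measurable.comp hg hY) μ
    _ ≤ I[Y : X ; μ] := mutual_comp_le μ hY hX g
    _ = I[X : Y ; μ] := mutualInfo_comm hY hX μ

/-- Let `X, Y, Z`. For any functions `f, g` on the ranges of `X, Y` respectively,
we have `I[f ∘ X : g ∘ Y | Z ; μ] ≤ I[X : Y | Z ; μ]`. [folklore] -/
lemma condMutual_comp_comp_le (μ : Measure Ω) [IsProbabilityMeasure μ] (hX : Measurable X)
    (hY : Measurable Y) (hZ : Measurable Z) (f : S → V) (g : T → W) (hg : Measurable g)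
    [FiniteRange X] [FiniteRange Y] [FiniteRange Z] :
    I[f ∘ X : g ∘ Y | Z ; μ] ≤ I[X : Y | Z ; μ] := by
  rw [condMutualInfo_eq_sum hZ, condMutualInfo_eq_sum hZ]
  apply Finset.sum_le_sum
  intro i _
  rcases eq_or_lt_of_le (measureReal_nonneg (μ := μ) (s := (Z ⁻¹' {i}))) with h | h
  · simp [← h]
  · gcongr
    have : IsProbabilityMeasure (μ[|Z ← i]) := by
      apply cond_isProbabilityMeasure_of_finite
      · exact (ENNReal.toReal_ne_zero.mp (ne_of_gt h)).left
      · exact (ENNReal.toReal_ne_zero.mp (ne_of_gt h)).right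
    apply mutual_comp_comp_le _ hX hY f g hg

end Literature.Combinatorics.Additive.PFR
end dataProcessing

section MeasureSpace_example

open ProbabilityTheory

variable {Ω S T : Type*} [MeasureSpace Ω] [IsZeroOrProbabilityMeasure (ℙ : Measure Ω)]
  [Fintype S] [Nonempty S] [MeasurableSpace S] [MeasurableSingletonClass S]
  [Fintype T] [Nonempty T] [MeasurableSpace T] [MeasurableSingletonClass T]
  {X : Ω → S} {Y : Ω → T}

namespace Literature.Combinatorics.Additive.PFR
/-- An example to illustrate how `MeasureSpace` can be used to suppress the ambient measure. -/
example (hX : Measurable X) (hY : Measurable Y) :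
  H[⟨X, Y⟩] = H[Y] + H[X | Y] := chain_rule _ hX hY

end Literature.Combinatorics.Additive.PFR
end MeasureSpace_example

end PFR_ForMathlib_Entropy_Basic

/-! ## Port of `PFR/ForMathlib/Entropy/Group.lean` -/
section PFR_ForMathlib_Entropy_Group
open Function MeasureTheory Measure Real
open scoped ENNReal NNReal Topology ProbabilityTheory

universe uΩ uS uT uU
variable {Ω : Type uΩ} {G : Type uS} {T : Type uT} {U : Type uU} [mΩ : MeasurableSpace Ω]
  [Countable G] [Countable T] [Countable U]
  [hG : MeasurableSpace G] [MeasurableSpace T] [MeasurableSpace U]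
  [MeasurableSingletonClass G] [MeasurableSingletonClass T] [MeasurableSingletonClass U]
  [Group G] {X Y : Ω → G} {μ : Measure Ω}

namespace Literature.Combinatorics.Additive.PFR
open scoped ProbabilityTheory
open ProbabilityTheory
section entropy

/-- `entropy_mul_const`: ported from PFR (`PFR/ForMathlib/Entropy/Group.lean`). [cite: GowersEtAl2025, Appendix A] -/
@[to_additive (attr := simp)]
lemma entropy_mul_const (hX : Measurable X) (c : G) :
    H[X * fun _ ↦ c; μ] = H[X ; μ] := by
  apply entropy_comp_of_injective μ hX _ <| mul_left_injective c

/-- `H[X, X * Y] = H[X, Y]`. [cite: GowersEtAl2025, Appendix A] -/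
@[to_additive /-- `H[X, X + Y] = H[X, Y]` -/]
lemma entropy_mul_right (hX : Measurable X) (hY : Measurable Y) (μ : Measure Ω) :
    H[⟨X, X * Y⟩; μ] = H[⟨X, Y⟩ ; μ] := by
  change H[(Equiv.refl _).prodShear Equiv.mulLeft ∘ ⟨X, Y⟩ ; μ] = H[⟨X, Y⟩ ; μ]
  exact entropy_comp_of_injective μ (hX.prodMk hY) _ <| Equiv.injective _

/-- `H[X, Y * X] = H[X, Y]` [cite: GowersEtAl2025, Appendix A] -/
@[to_additive /-- `H[X, Y + X] = H[X, Y]` -/]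
lemma entropy_mul_right' (hX : Measurable X) (hY : Measurable Y) (μ : Measure Ω) :
    H[⟨X, Y * X⟩; μ] = H[⟨X, Y⟩ ; μ] := by
  change H[(Equiv.refl _).prodShear Equiv.mulRight ∘ ⟨X, Y⟩ ; μ] = H[⟨X, Y⟩ ; μ]
  exact entropy_comp_of_injective μ (hX.prodMk hY) _ <| Equiv.injective _

/-- `H[Y * X, Y] = H[X, Y]` [cite: GowersEtAl2025, Appendix A] -/
@[to_additive /-- `H[Y + X, Y] = H[X, Y]` -/]
lemma entropy_mul_left (hX : Measurable X) (hY : Measurable Y) (μ : Measure Ω) :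
    H[⟨Y * X, Y⟩; μ] = H[⟨X, Y⟩ ; μ] :=
  (entropy_comm (hY.mul hX) hY _).trans <| (entropy_mul_right hY hX _).trans <| entropy_comm hY hX _

/-- `H[X * Y, Y] = H[X, Y]` [cite: GowersEtAl2025, Appendix A] -/
@[to_additive /-- `H[X + Y, Y] = H[X, Y]` -/]
lemma entropy_mul_left' (hX : Measurable X) (hY : Measurable Y) (μ : Measure Ω) :
    H[⟨X * Y, Y⟩; μ] = H[⟨X, Y⟩ ; μ] :=
  (entropy_comm (hX.mul hY) hY _).trans <| (entropy_mul_right' hY hX _).trans <|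
    entropy_comm hY hX _

/-- `H[X, Y⁻¹] = H[X, Y]` [cite: GowersEtAl2025, Appendix A] -/
@[to_additive /-- `H[X, -Y] = H[X, Y]` -/]
lemma entropy_inv_right (hX : Measurable X) (hY : Measurable Y) (μ : Measure Ω) :
    H[⟨X, Y⁻¹⟩; μ] = H[⟨X, Y⟩ ; μ] := by
  change H[(Equiv.refl _).prodCongr (Equiv.inv _) ∘ ⟨X, Y⟩ ; μ] = H[⟨X, Y⟩ ; μ]
  exact entropy_comp_of_injective μ (hX.prodMk hY) _ (Equiv.injective _)

/-- `H[X⁻¹, Y] = H[X, Y]` [cite: GowersEtAl2025, Appendix A] -/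
@[to_additive /-- `H[-X, Y] = H[X, Y]` -/]
lemma entropy_inv_left (hX : Measurable X) (hY : Measurable Y) (μ : Measure Ω) :
    H[⟨X⁻¹, Y⟩; μ] = H[⟨X, Y⟩ ; μ] := by
  change H[(Equiv.inv _).prodCongr (Equiv.refl _) ∘ ⟨X, Y⟩ ; μ] = H[⟨X, Y⟩ ; μ]
  exact entropy_comp_of_injective μ (hX.prodMk hY) _ (Equiv.injective _)

/-- `H[X, X / Y] = H[X, Y]` [cite: GowersEtAl2025, Appendix A] -/
@[to_additive /-- `H[X, X - Y] = H[X, Y]` -/]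
lemma entropy_div_right (hX : Measurable X) (hY : Measurable Y) (μ : Measure Ω) :
    H[⟨X, X / Y⟩; μ] = H[⟨X, Y⟩ ; μ] := by
  change H[(Equiv.refl _).prodShear Equiv.divLeft ∘ ⟨X, Y⟩ ; μ] = H[⟨X, Y⟩ ; μ]
  exact entropy_comp_of_injective μ (hX.prodMk hY) _ (Equiv.injective _)

/-- `H[X, Y / X] = H[X, Y]` [cite: GowersEtAl2025, Appendix A] -/
@[to_additive /-- `H[X, Y - X] = H[X, Y]` -/]
lemma entropy_div_right' (hX : Measurable X) (hY : Measurable Y) (μ : Measure Ω) :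
    H[⟨X, Y / X⟩; μ] = H[⟨X, Y⟩ ; μ] := by
  change H[(Equiv.refl _).prodShear Equiv.divRight ∘ ⟨X, Y⟩ ; μ] = H[⟨X, Y⟩ ; μ]
  exact entropy_comp_of_injective μ (hX.prodMk hY) _ (Equiv.injective _)

/-- `H[Y / X, Y] = H[X, Y]` [cite: GowersEtAl2025, Appendix A] -/
@[to_additive /-- `H[Y - X, Y] = H[X, Y]` -/]
lemma entropy_div_left (hX : Measurable X) (hY : Measurable Y) (μ : Measure Ω) :
    H[⟨Y / X, Y⟩; μ] = H[⟨X, Y⟩ ; μ] :=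
  (entropy_comm (hY.div hX) hY _).trans <| (entropy_div_right hY hX _).trans <| entropy_comm hY hX _

/-- `H[X / Y, Y] = H[X, Y]` [cite: GowersEtAl2025, Appendix A] -/
@[to_additive /-- `H[X - Y, Y] = H[X, Y]` -/]
lemma entropy_div_left' (hX : Measurable X) (hY : Measurable Y) (μ : Measure Ω) :
    H[⟨X / Y, Y⟩; μ] = H[⟨X, Y⟩ ; μ] :=
  (entropy_comm (hX.div hY) hY _).trans <| (entropy_div_right' hY hX _).trans <|
    entropy_comm hY hX _

/-- If `X` is `G`-valued, then `H[X⁻¹]=H[X]`. [cite: GowersEtAl2025, Appendix A] -/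
@[to_additive /-- If `X` is `G`-valued, then `H[-X]=H[X]`. -/]
lemma entropy_inv (hX : Measurable X) : H[X⁻¹ ; μ] = H[X ; μ] :=
  entropy_comp_of_injective μ hX (·⁻¹) inv_injective

/-- `H[X / Y] = H[Y / X]` [cite: GowersEtAl2025, Appendix A] -/
@[to_additive /-- `H[X - Y] = H[Y - X]` -/]
lemma entropy_div_comm {Y : Ω → G} (hX : Measurable X) (hY : Measurable Y) :
    H[X / Y ; μ] = H[Y / X ; μ] := by rw [← inv_div]; exact entropy_inv (hY.div hX)

/-- `max(H[X | Z], H[Y | Z]) - I[X : Y | Z] ≤ H[X / Y | Z]` [cite: GowersEtAl2025, Appendix A] -/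
@[to_additive /-- `max(H[X | Z], H[Y | Z]) - I[X : Y | Z] ≤ H[X - Y | Z]` -/]
lemma max_condEntropy_sub_condMutualInfo_le_condEntropy_div [FiniteRange X] [FiniteRange Y]
    {Z : Ω → T} (hX : Measurable X) (hY : Measurable Y) (hZ : Measurable Z)
    [IsProbabilityMeasure μ] [FiniteRange Z] :
    (max H[X | Z ; μ] H[Y | Z ; μ]) - I[X : Y | Z ; μ] ≤ H[X / Y | Z ; μ] := by
  rw [condMutualInfo_comm hX hY, condEntropy_eq_kernel_entropy hX hZ,
    condEntropy_eq_kernel_entropy hY hZ, condMutualInfo_eq_kernel_mutualInfo hY hX hZ,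
    condEntropy_eq_kernel_entropy ?_ hZ]
  swap ; · exact hX.div hY
  rw [Kernel.entropy_congr (condDistrib_snd_ae_eq hY hX hZ μ).symm,
    Kernel.entropy_congr (condDistrib_fst_ae_eq hY hX hZ μ).symm, max_comm]
  refine (Kernel.max_entropy_sub_mutualInfo_le_entropy_div _ _ ?_).trans_eq ?_
  · exact Kernel.aefiniteKernelSupport_condDistrib _ _ _ (hY.prodMk hX) hZ
  rw [Kernel.entropy_div_comm]
  have h := condDistrib_comp Z (hY.prodMk hX).aemeasurable
    (f := fun x ↦ x.2 / x.1) (by fun_prop) (μ := μ) (mβ := inferInstance)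
  rw [Kernel.entropy_congr h.symm]
  rfl

end entropy

section condEntropy
variable [IsFiniteMeasure μ] [FiniteRange Y]

/-- `H[Y * X | Y] = H[X | Y]` [cite: GowersEtAl2025, Appendix A] -/
@[to_additive /-- `H[Y + X | Y] = H[X | Y]` -/]
lemma condEntropy_mul_left (hX : Measurable X) (hY : Measurable Y) :
     H[Y * X | Y ; μ] = H[X | Y ; μ] :=
  condEntropy_of_injective μ hX hY (fun y x ↦ y * x) mul_right_injective

/-- `H[X * Y | Y] = H[X | Y]` [cite: GowersEtAl2025, Appendix A] -/
@[to_additive /-- `H[X + Y | Y] = H[X | Y]` -/]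
lemma condEntropy_mul_right (hX : Measurable X) (hY : Measurable Y) :
    H[X * Y | Y ; μ] = H[X | Y ; μ] :=
  condEntropy_of_injective μ hX hY (fun y x ↦ x * y) mul_left_injective

/-- `H[Y / X | Y] = H[X | Y]` [cite: GowersEtAl2025, Appendix A] -/
@[to_additive /-- `H[Y - X | Y] = H[X | Y]` -/]
lemma condEntropy_div_left (hX : Measurable X) (hY : Measurable Y) :
    H[Y / X | Y ; μ] = H[X | Y ; μ] :=
  condEntropy_of_injective μ hX hY (fun y x ↦ y / x) fun _ ↦ div_right_injective

/-- `H[X / Y | Y] = H[X | Y]` [cite: GowersEtAl2025, Appendix A] -/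
@[to_additive /-- `H[X - Y | Y] = H[X | Y]` -/]
lemma condEntropy_div_right (hX : Measurable X) (hY : Measurable Y) :
    H[X / Y | Y ; μ] = H[X | Y ; μ] :=
  condEntropy_of_injective μ hX hY (fun y x ↦ x / y) fun _ ↦ div_left_injective

end condEntropy

section mutualInfo

variable [FiniteRange X] [FiniteRange Y]

/-- `I[X : X * Y] = H[X * Y] - H[Y]` iff `X, Y` are independent. [cite: GowersEtAl2025, Appendix A] -/
@[to_additive /-- `I[X : X + Y] = H[X + Y] - H[Y]` iff `X, Y` are independent. -/]
lemma mutualInfo_mul_right (hX : Measurable X) (hY : Measurable Y) {μ : Measure Ω}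
    [IsProbabilityMeasure μ] (h : IndepFun X Y μ) :
    I[X : X * Y ; μ] = H[X * Y ; μ] - H[Y ; μ] := by
  rw [mutualInfo_def, entropy_mul_right hX hY, h.entropy_pair_eq_add hX hY]
  abel

end mutualInfo

section IsProbabilityMeasure
variable [IsProbabilityMeasure μ] {Y : Ω → G} [FiniteRange X] [FiniteRange Y]

/-- `H[X] - I[X : Y] ≤ H[X * Y]` [cite: GowersEtAl2025, Appendix A] -/
@[to_additive /-- `H[X] - I[X : Y] ≤ H[X + Y]` -/]
lemma entropy_sub_mutualInfo_le_entropy_mul (hX : Measurable X) (hY : Measurable Y) :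
    H[X ; μ] - I[X : Y ; μ] ≤ H[X * Y ; μ] := by
  rw [entropy_sub_mutualInfo_eq_condEntropy hX hY, ← condEntropy_mul_right hX hY]
  exact condEntropy_le_entropy _ (hX.mul hY) hY

/-- `H[Y] - I[X : Y] ≤ H[X * Y]` [cite: GowersEtAl2025, Appendix A] -/
@[to_additive /-- `H[Y] - I[X : Y] ≤ H[X + Y]` -/]
lemma entropy_sub_mutualInfo_le_entropy_mul' (hX : Measurable X) (hY : Measurable Y) :
    H[Y ; μ] - I[X : Y ; μ] ≤ H[X * Y ; μ] := by
  rw [entropy_sub_mutualInfo_eq_condEntropy' hX hY, ← condEntropy_mul_left hY hX]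
  exact condEntropy_le_entropy _ (hX.mul hY) hX

/-- `H[X] - I[X : Y] ≤ H[X / Y]` [cite: GowersEtAl2025, Appendix A] -/
@[to_additive /-- `H[X] - I[X : Y] ≤ H[X - Y]` -/]
lemma entropy_sub_mutualInfo_le_entropy_div (hX : Measurable X) (hY : Measurable Y) :
    H[X ; μ] - I[X : Y ; μ] ≤ H[X / Y ; μ] := by
  rw [entropy_sub_mutualInfo_eq_condEntropy hX hY, ← condEntropy_div_right hX hY]
  exact condEntropy_le_entropy _ (hX.div hY) hY

/-- `H[Y] - I[X : Y] ≤ H[X / Y]` [cite: GowersEtAl2025, Appendix A] -/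
@[to_additive /-- `H[Y] - I[X : Y] ≤ H[X - Y]` -/]
lemma entropy_sub_mutualInfo_le_entropy_div' (hX : Measurable X) (hY : Measurable Y) :
    H[Y ; μ] - I[X : Y ; μ] ≤ H[X / Y ; μ] := by
  rw [mutualInfo_comm hX hY, entropy_sub_mutualInfo_eq_condEntropy hY hX,
    ← condEntropy_div_left hY hX]
  exact condEntropy_le_entropy _ (hX.div hY) hX

/-- `max(H[X], H[Y]) - I[X : Y] ≤ H[X * Y]` [cite: GowersEtAl2025, Appendix A] -/
@[to_additive /-- `max(H[X], H[Y]) - I[X : Y] ≤ H[X + Y]` -/]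
lemma max_entropy_sub_mutualInfo_le_entropy_mul (hX : Measurable X) (hY : Measurable Y) :
    max H[X ; μ] H[Y ; μ] - I[X : Y ; μ] ≤ H[X * Y ; μ] := by
  rw [← max_sub_sub_right, max_le_iff]
  exact ⟨entropy_sub_mutualInfo_le_entropy_mul hX hY, entropy_sub_mutualInfo_le_entropy_mul' hX hY⟩

/-- `max(H[X], H[Y]) - I[X : Y] ≤ H[X / Y]` [cite: GowersEtAl2025, Appendix A] -/
@[to_additive /-- `max(H[X], H[Y]) - I[X : Y] ≤ H[X - Y]` -/]
lemma max_entropy_sub_mutualInfo_le_entropy_div (hX : Measurable X) (hY : Measurable Y) :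
    max H[X ; μ] H[Y ; μ] - I[X : Y ; μ] ≤ H[X / Y ; μ] := by
  rw [← max_sub_sub_right, max_le_iff]
  exact ⟨entropy_sub_mutualInfo_le_entropy_div hX hY, entropy_sub_mutualInfo_le_entropy_div' hX hY⟩

/-- `max(H[X | Z], H[Y | Z]) - I[X : Y | Z] ≤ H[X * Y | Z]` [cite: GowersEtAl2025, Appendix A] -/
@[to_additive /-- `max(H[X | Z], H[Y | Z]) - I[X : Y | Z] ≤ H[X + Y | Z]` -/]
lemma max_condEntropy_sub_condMutualInfo_le_condEntropy_mul {Z : Ω → T} [FiniteRange Z]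
    (hX : Measurable X) (hY : Measurable Y) (hZ : Measurable Z) :
    max H[X | Z ; μ] H[Y | Z ; μ] - I[X : Y | Z ; μ] ≤ H[X * Y | Z ; μ] := by
  rw [condMutualInfo_comm hX hY, condEntropy_eq_kernel_entropy hX hZ,
    condEntropy_eq_kernel_entropy hY hZ, condMutualInfo_eq_kernel_mutualInfo hY hX hZ,
    condEntropy_eq_kernel_entropy (show Measurable (X * Y) from hX.mul hY) hZ]
  rw [Kernel.entropy_congr (condDistrib_snd_ae_eq hY hX hZ μ).symm,
    Kernel.entropy_congr (condDistrib_fst_ae_eq hY hX hZ μ).symm,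
    max_comm]
  refine (Kernel.max_entropy_sub_mutualInfo_le_entropy_mul' _ _ ?_).trans_eq ?_
  · exact Kernel.aefiniteKernelSupport_condDistrib _ _ _ (hY.prodMk hX) hZ
  have h := condDistrib_comp Z (hY.prodMk hX).aemeasurable
    (f := fun x ↦ x.2 * x.1) (by fun_prop) (μ := μ) (mβ := inferInstance)
  rw [Kernel.entropy_congr h.symm]
  rfl

/-- If `X, Y` are independent, then `max(H[X], H[Y]) ≤ H[X * Y]`. [cite: GowersEtAl2025, Appendix A] -/
@[to_additive /-- If `X, Y` are independent, then `max(H[X], H[Y]) ≤ H[X + Y]` -/]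
lemma max_entropy_le_entropy_mul (hX : Measurable X) (hY : Measurable Y) (h : IndepFun X Y μ) :
    max H[X ; μ] H[Y ; μ] ≤ H[X * Y ; μ] := by
  simpa [h.mutualInfo_eq_zero hX hY] using max_entropy_sub_mutualInfo_le_entropy_mul hX hY (μ := μ)

/-- If `X, Y` are independent, then `max(H[X], H[Y]) ≤ H[X / Y]`. [cite: GowersEtAl2025, Appendix A] -/
@[to_additive /-- If `X, Y` are independent, then `max(H[X], H[Y]) ≤ H[X - Y]`. -/]
lemma max_entropy_le_entropy_div (hX : Measurable X) (hY : Measurable Y) (h : IndepFun X Y μ) :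
    max H[X ; μ] H[Y ; μ] ≤ H[X / Y ; μ] := by
  simpa [h.mutualInfo_eq_zero hX hY] using max_entropy_sub_mutualInfo_le_entropy_div hX hY (μ := μ)

/-- If `X₁, ..., Xₙ` are independent and `s ⊆ {1, ..., n}`, then for all `i ∈ s`,
`H[Xᵢ] ≤ H[∏ j ∈ s, Xⱼ]`. [cite: GowersEtAl2025, Appendix A] -/
@[to_additive /-- If `X₁, ..., Xₙ` are independent and `s ⊆ {1, ..., n}`, then for all `i ∈ s`,
`H[Xᵢ] ≤ H[∑ j ∈ s, Xⱼ]`. -/]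
lemma max_entropy_le_entropy_prod {G : Type*} [Countable G] [hG : MeasurableSpace G]
    [MeasurableSingletonClass G] [CommGroup G] [MeasurableMul₂ G]
    {I : Type*} {s : Finset I} {i₀ : I} (hi₀ : i₀ ∈ s) {X : I → Ω → G} [∀ i, FiniteRange (X i)]
    (hX : (i : I) → Measurable (X i)) (h_indep : iIndepFun X μ) :
    H[X i₀ ; μ] ≤ H[∏ i ∈ s, X i ; μ] := by
  have hs : s.Nonempty := ⟨i₀, hi₀⟩
  induction hs using Finset.Nonempty.cons_induction with
  | singleton i => simp_all
  | cons j s Hnot _ Hind =>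
  rw [Finset.prod_cons]
  rcases Finset.mem_cons.mp hi₀ with rfl | hi₀
  · calc
      _ ≤ max H[X i₀ ; μ] H[∏ i ∈ s, X i ; μ] := le_max_left _ _
      _ ≤ H[X i₀ * ∏ i ∈ s, X i ; μ] := by
        refine max_entropy_le_entropy_mul (hX i₀) (by fun_prop) ?_
        exact iIndepFun.indepFun_finsetProd_of_notMem h_indep hX Hnot |>.symm
  · calc
      _ ≤ H[∏ i ∈ s, X i ; μ] := Hind hi₀
      _ ≤ max H[X j ; μ] H[∏ i ∈ s, X i ; μ] := le_max_right _ _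
      _ ≤ H[X j * ∏ x ∈ s, X x ; μ] := by
        refine max_entropy_le_entropy_mul (hX j) (by fun_prop) ?_
        exact iIndepFun.indepFun_finsetProd_of_notMem h_indep hX Hnot |>.symm

end IsProbabilityMeasure
end Literature.Combinatorics.Additive.PFR

end PFR_ForMathlib_Entropy_Group
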